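import Summits.HodgeConjecture.HodgeConjecture.Cruxes.BlochSeedDiscOne.RingTwoMassLaw
import Summits.HodgeConjecture.HodgeConjecture.Cruxes.BlochSeedDiscOne.DeepLayerLaws

/-!
# FineDoorRing2 — door (H2) READ WITH THE D-MASS FUNCTIONALS empties ring 2 below 520 copies
(hsemireg-sheaf8-1 g6, R-B custody instrument; memo `Cruxes/BlochSeedDiscOne/FINE-DOOR-RING2-sheaf8-1-g6.md` 7e47c4d147470e58)

Token: line stmt-HodgeConjecture-18881 Cruxes/BlochSeedDiscOne/Lines/birth.lean 814a6a70c14e831a stub_rung_pad4_seedAt.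
LETTER-MODEL BOOKKEEPING ONLY (`DepthBoundA4.Design` on the height-14 alphabet, ring 2 = co-level ≤ 2).  Letters ≠ displays ≠ sheaves ≠ SEED;
nothing here is proved toward HC ∕ HC_CM ∕ HC_AV ∕ №4 ∕ 26512 ∕ 18881 ∕ H2; `Nonex 14 199 8` stays REFUTED as typed (`RotatedPairB136`).
No `axiom` ∕ `sorry` ∕ `native_decide` ∕ `unsafe`; the only `instance`s are three PRIVATE `Decidable` unfoldings (`inferInstance` after `unfold`)
used by `decide` on the finite alphabet.  v1.4∕v1.5: imports `RingTwoMassLaw` (plan-lens-HodgeAV-dual g14∕g15, BUILT on the farm since 02:54Z, req-158) and `DeepLayerLaws` (strengthen, built)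
for the shallow ring-2 API (`R2 ∕ Ring2 ∕ F1 ∕ F2 ∕ F3` + helpers; v1.0–v1.3 carried verbatim copies while the module was unbuilt) AND for the deep
regime law `regime_noNunit4_hall8U` (`NoNUnit4 → 520 ≤ copies`, unconditional), so the final theorems `fineDoor_copies_ge_520 ∕ _ge_400 ∕
fineDoor_empty_le_519 ∕ _le_108` are now UNCONDITIONAL IN THE KERNEL (no displayed hypothesis; the `_of` forms are kept for readers).

## The two readings of door (H2)
* COARSE = `LeggedFloor.RuleD` (memo-152; the door of `RuleDPlate.SPlusB`): every detecting block has A supplier.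
* FINE = c4-1 g10 THEOREM D-MASS (director R19.405 «RULE D with multiplicities»; typed over `MCell` in `C4StabilitySpec.lean` § DMass):
  per block `g < j` AND per pair of covectors `(λ, μ)` detecting `M₁` or `M₂`, the row `m(cell) ≤ Σ_{counted} h⁰ · m(partner)`, a leg ∕ (r2a)
  partner whose line is annihilated by `λ` (on `g`) resp. `μ` (on `j`) NOT being counted.  §1 transcribes § DMass's `blockM₁ ∕ blockM₂ ∕ lineVec ∕
  Annihilates ∕ Detects ∕ DMassValid ∕ IsLegBelow ∕ IsR2aBelow ∕ DMassCounts` VERBATIM to `DepthBoundA4.Letter ∕ Cell` (`α ↦ a`, `β ↦ Letter.beta`)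
  and states the fine door at SUPPORT level, P side (`RuleDPFine`: every valid functional of every supported P-cell has a COUNTED server in
  `suppN` — the indicator shadow of the D-MASS-P rows, which is all that is used).

## What is proved (kernel)
* `no_ahook` (LEMMA A of the memo): under `OnAlphabet 14 ∧ Ring2 ∧ Disj ∧ RuleD ∧ RuleDPFine` NO supported P-cell is an A-hook `(A; u, u, u)`:
  the functional (`annA` on the floor slot, `e_A*` on a unit slot) is valid (`decide` on the 13-letter alphabet) and its counted servers are the
  cell itself (✗ `Disj`) or agree with the hook off the unit slot (✗ LAW F3 — in the kernel the raised letter need not even be named).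
* `no_hook` ∕ `no_hook_at` (LEMMA A′, unit-pair functional `annU` ⊗ `e_A*`): NO hook of either kind — `(A; u,u,u)` or `(B; u,u,u)` — is a supported
  P-cell (only `Disj` + LAW F3; no (A1)); `noNUnit4_of_fine`: hence no supported N-cell is unit⁴ (LAW F2 closes the two-floor case).
* `fineDoor_copies_ge_520` (v1.4, unconditional): hence `520 ≤ copies` by dual's regime law; `fineDoor_empty_le_108`: the open cell of the ring
  ledger (copies ≤ 108, `SigmaH.copies_le_108_of_budget`) is EMPTY behind the fine door — KERNEL, no displayed hypothesis.
* §4b `lift_law ∕ lift_law_fst` (EVERY SHELL, no ring ∕ (A1) ∕ LAW F hypothesis): behind the fine door a supported P-cell with two unit slots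
  `g < j` has both SINGLE-HUB LIFTS `x[j ↦ H]`, `x[g ↦ H]` in `suppN` (the unit-pair functional; the forced core of every fine closure).
* §6 (v1.5, director R19.685 (2)) **FINE SHELL 3**: `charged_N_fine_ring3` — behind the fine door a hub-free supported N-cell of shell 3
  (`DeepLayerLaws.RingLe 3`) has NO deep letter and AT MOST ONE mid letter, i.e. one of the ring-2 shapes `u⁴ ∕ (A;u,u,u) ∕ (B;u,u,u)`
  (machine: fine room 8940f2df8ed13676, charged N orbits 140 → 31); via the A-slot lift laws `liftA_unit ∕ liftA_A`, the fine deaths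
  `noP_deep_mid_unit_unit ∕ noP_deep_A_mid_unit ∕ noP_deep_AAA ∕ noN_deep_unit_charged ∕ noN_AA_charged ∕ noN_mid_B_unit_unit`, and three
  COARSE slot laws of strengthen's `RingThreeAnatomy` re-derived as one-liners from `DeepLayerLaws` (imported; `RingThreeAnatomy` unbuilt).
* §6b (v1.6, director R19.691) `offaxisN_le_one_fine_ring3 ∕ offaxisP_le_two_fine_ring3`: behind the fine door on shell 3 every hub-free supported
  N-cell has ≤ 1 and every hub-free supported P-cell ≤ 2 OFF-AXIS letters (`x ≠ 0 ∧ y ≠ 0`) — exactly the displayed room hypotheses of anomaly g16's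
  `CoverCount.classA_ten_cells ∕ classB_seven_cells` (`offCount` restated definitionally; `CoverCount` imports the unbuilt `BoxIdentity`); via the general
  single-line lifts `liftU ∕ liftA` (unit ∕ mid-axis slot to ANY non-hub slot) and the fine deaths of the P-cells `BBBB ∕ BBBu ∕ BBBA`.
* §5: the MASS form of the fine door over `Design` (`kFactor ∕ homDim ∕ capN ∕ capP ∕ DMassN ∕ DMassP ∕ FineDoor`, transcription of the spec's
  `dmassCapN|P ∕ DMassRowN|P ∕ DMassAll`) and `ruleDPFine_of_dmassP : DMassP → RuleDPFine` (the support shadow), `noNUnit4_of_fineDoor`.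
The COARSE statement of record `SPlus 14 sigmaH 0` is NOT touched (its door is `RuleD`); negation g21's BB-PAIR claim (R19.674) is neither used
nor confirmed.  Escape doors as VERDICT v4.30 l.85 (≥ 3-term displays, non-split atoms, smaller tangent models, READING 2).
-/

set_option linter.dupNamespace false
set_option autoImplicit false

namespace Summit.HodgeConjecture.HodgeConjecture.Cruxes.BlochSeedDiscOne.FineDoorRing2

open Summit.HodgeConjecture.HodgeConjecture.Cruxes.BlochSeedDiscOne.DepthBoundA4
open Summit.HodgeConjecture.HodgeConjecture.Cruxes.BlochSeedDiscOne.LeggedFloor (NullStep Supplies Detects RuleD Disj)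
open Summit.HodgeConjecture.HodgeConjecture.Cruxes.BlochSeedDiscOne.RuleDPlate (HallPlusUp)
open Summit.HodgeConjecture.HodgeConjecture.Cruxes.BlochSeedDiscOne.RingTwoMassLaw
  (R2 mem_R2 Ring2 memR2_of_supp R2_levels level_ge_12 level_eq_14_iff not_null_to_floor null_to_13 detects_of_ne_14 levels_of_not_detects
   supplies_symm detects_symm supplier_of_N witness_of_P cell_eq_of_supplies exists_fourth F1 F2 F3 IsUnitL IsDiagL IsAxFlL u4B NoNUnit4
   mem_supp_of_memP mem_supp_of_memN regime_noNunit4_hall8U regime_noNunit4U massLawHall8U)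
open Summit.HodgeConjecture.HodgeConjecture.Cruxes.BlochSeedDiscOne.DeepLayerLaws (RingLe sum_rule_N_hub sum_rule_N_axis sum_rule_P_hub colevel_hub)

/-! ## §1 The fine door (transcription of `C4StabilitySpec` § DMass to `Letter ∕ Cell`) -/

/-- a Gaussian integer from an integer. -/
def intG (n : ℤ) : GaussianInt := ⟨n, 0⟩

/-- `M₁`: the coefficient of `k_{jg}` in the `(g,j)`-block of `ob_κ(L_c)`: `[[conj β_j, a_j − a_g], [0, −β_g]]`. -/
def blockM₁ (c : Cell) (g j : Fin 4) : Matrix (Fin 2) (Fin 2) GaussianInt :=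
  !![star (c j).beta, intG ((c j).a - (c g).a); 0, -(c g).beta]

/-- `M₂`: the coefficient of `k_{gj}`: `[[−conj β_g, 0], [a_j − a_g, β_j]]`. -/
def blockM₂ (c : Cell) (g j : Fin 4) : Matrix (Fin 2) (Fin 2) GaussianInt :=
  !![-star (c g).beta, 0; intG ((c j).a - (c g).a), (c j).beta]

/-- the line vector `(Δa, β_Δ)` of the difference `up − lo` on one factor. -/
def lineVec (lo up : Letter) : Fin 2 → GaussianInt := ![intG (up.a - lo.a), up.beta - lo.beta]

/-- the bilinear pairing of a covector with a vector of `V_f` (no conjugation). -/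
def gPairing (l v : Fin 2 → GaussianInt) : GaussianInt := l 0 * v 0 + l 1 * v 1

/-- `λ` annihilates the line of the difference `up − lo`. -/
def Annihilates (l : Fin 2 → GaussianInt) (lo up : Letter) : Prop := gPairing l (lineVec lo up) = 0

/-- `(λ ⊗ μ)(M) ≠ 0`. -/
def FDetects (l m : Fin 2 → GaussianInt) (M : Matrix (Fin 2) (Fin 2) GaussianInt) : Prop :=
  l 0 * M 0 0 * m 0 + l 0 * M 0 1 * m 1 + l 1 * M 1 0 * m 0 + l 1 * M 1 1 * m 1 ≠ 0

/-- a D-MASS functional `(g, j; λ, μ)` is VALID for the cell `c`: `g < j` and `λ ⊗ μ` detects `M₁` or `M₂`. -/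
def DMassValid (c : Cell) (g j : Fin 4) (l m : Fin 2 → GaussianInt) : Prop :=
  g < j ∧ (FDetects l m (blockM₁ c g j) ∨ FDetects l m (blockM₂ c g j))

/-- LEG on `g`: a null step on the factor `g`, equal on the other three. -/
def IsLeg (lo up : Cell) (g : Fin 4) : Prop := NullStep (lo g) (up g) ∧ ∀ f : Fin 4, f ≠ g → lo f = up f

/-- (r2a) partner on `(g, j)`: null steps on `g` and `j`, equal elsewhere. -/
def IsR2a (lo up : Cell) (g j : Fin 4) : Prop :=
  g ≠ j ∧ NullStep (lo g) (up g) ∧ NullStep (lo j) (up j) ∧ ∀ f : Fin 4, f ≠ g → f ≠ j → lo f = up f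

/-- the pair `lo ≤ up` is COUNTED by the functional `(g, j; λ, μ)`: identical, a leg on `g` not annihilated by `λ`, a leg on `j` not annihilated by
`μ`, or an (r2a) partner with neither line annihilated (spec `DMassCounts`). -/
def DMassCounts (lo up : Cell) (g j : Fin 4) (l m : Fin 2 → GaussianInt) : Prop :=
  lo = up ∨
  (IsLeg lo up g ∧ ¬ Annihilates l (lo g) (up g)) ∨
  (IsLeg lo up j ∧ ¬ Annihilates m (lo j) (up j)) ∨
  (IsR2a lo up g j ∧ ¬ Annihilates l (lo g) (up g) ∧ ¬ Annihilates m (lo j) (up j))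

/-- **THE FINE DOOR, P side, support level**: every supported P-cell, every block and every VALID functional has a COUNTED server in `suppN`
(the indicator shadow of the D-MASS-P row `m_P(x) ≤ Σ_{counted y} h⁰(y − x)·m_N(y)`, THEOREM D-MASS upper level). -/
def RuleDPFine (D : Design) : Prop :=
  ∀ x ∈ D.suppP, ∀ g j : Fin 4, ∀ l m : Fin 2 → GaussianInt, DMassValid x g j l m → ∃ y ∈ D.suppN, DMassCounts x y g j l m

/-! ## §2 The functionals of LEMMA A and the finite alphabet facts -/

/-- the covector `e_A* = (1, 0)`. -/
def eA : Fin 2 → GaussianInt := ![1, 0]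

/-- for an axis-floor letter `A`, TWICE the annihilator of the line `A → u(A)` (`u(A)` the unit above `A`; `β_A = 2β_u`): `(−β_A, −2)`. -/
def annA (A : Letter) : Fin 2 → GaussianInt := ![-A.beta, intG (-2)]

private instance decNull (ℓ ℓ' : Letter) : Decidable (NullStep ℓ ℓ') := by unfold NullStep; infer_instance
private instance decAnn (l : Fin 2 → GaussianInt) (lo up : Letter) : Decidable (Annihilates l lo up) := by
  unfold Annihilates; infer_instance
private instance decDet (l m : Fin 2 → GaussianInt) (M : Matrix (Fin 2) (Fin 2) GaussianInt) : Decidable (FDetects l m M) := by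
  unfold FDetects; infer_instance

/-- levels of the letter shapes on the ring-2 alphabet. -/
theorem R2_shape_levels : ∀ ℓ ∈ R2, (IsUnitL ℓ → ℓ.a = 13) ∧ (IsAxFlL ℓ → ℓ.a = 12) ∧ (IsDiagL ℓ → ℓ.a = 12) ∧
    (ℓ.a = 12 → IsAxFlL ℓ ∨ IsDiagL ℓ) := by decide

/-- (L1) `annA A` annihilates every null step out of an axis-floor letter inside the alphabet (`A → u(A)` and `A → H` share one line). -/
theorem annA_annihilates : ∀ A ∈ R2, ∀ ℓ ∈ R2, IsAxFlL A → NullStep A ℓ → Annihilates (annA A) A ℓ := by decide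

/-- (L3a) validity, floor slot first: `annA(A)ᵀ · [[conj β_u, 13 − 12],[0, −β_A]] · e_A* = −β_A·conj β_u ≠ 0`. -/
theorem detects_floor_first : ∀ A ∈ R2, ∀ u ∈ R2, IsAxFlL A → IsUnitL u →
    FDetects (annA A) eA !![star u.beta, intG (u.a - A.a); 0, -A.beta] := by decide

/-- (L3b) validity, unit slot first: `e_A*ᵀ · [[conj β_A, 12 − 13],[0, −β_u]] · annA(A) = −|β_A|² + 2 ≠ 0`. -/
theorem detects_unit_first : ∀ u ∈ R2, ∀ A ∈ R2, IsUnitL u → IsAxFlL A →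
    FDetects eA (annA A) !![star A.beta, intG (A.a - u.a); 0, -u.beta] := by decide

/-- for a unit `u`, the annihilator of the line `u → H` (the ONLY null step up from a unit inside the alphabet): `(−β_u, −1)`. -/
def annU (u : Letter) : Fin 2 → GaussianInt := ![-u.beta, intG (-1)]

/-- (L4) `annU u` annihilates every null step out of a unit inside the alphabet. -/
theorem annU_annihilates : ∀ u ∈ R2, ∀ ℓ ∈ R2, IsUnitL u → NullStep u ℓ → Annihilates (annU u) u ℓ := by decide

/-- (L5) validity of the UNIT-PAIR functional (`annU` on the first unit slot, `e_A*` on the second): value `−β_u·conj β_u′ ≠ 0`. -/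
theorem detects_unit_pair : ∀ u ∈ R2, ∀ u' ∈ R2, IsUnitL u → IsUnitL u' →
    FDetects (annU u) eA !![star u'.beta, intG (u'.a - u.a); 0, -u.beta] := by decide

/-! ## §3 LEMMA A — no A-hook on the P side -/

section
variable {D : Design}

/-- the F3 contradiction: a supported N-cell that agrees with an A-hook off one unit slot `j` cannot exist, WHATEVER its letter on `j`
(LAW F3: a floor slot and a unit slot force hubs on the two remaining slots, one of which carries a unit of the hook). -/
theorem no_raised_hook (hD : D.OnAlphabet 14) (hR : Ring2 D) (hdisj : Disj D) (hrule : RuleD D)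
    {x y : Cell} (hy : y ∈ D.suppN) (hxR : ∀ t : Fin 4, x t ∈ R2) {f j : Fin 4} (hfj : f ≠ j)
    (hA : IsAxFlL (x f)) (hu : ∀ g : Fin 4, g ≠ f → IsUnitL (x g))
    (heq : ∀ t : Fin 4, t ≠ j → x t = y t) : False := by
  obtain ⟨s, hsf, hsj, -⟩ := exists_fourth f j j
  obtain ⟨t, htf, hts, htj⟩ := exists_fourth f s j
  have hyf : (y f).a = 12 := by rw [← heq f hfj]; exact (R2_shape_levels _ (hxR f)).2.1 hA
  have hys : (y s).a = 13 := by rw [← heq s hsj]; exact (R2_shape_levels _ (hxR s)).1 (hu s hsf)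
  have hyt : (y t).a = 14 := F3 hD hR hdisj hrule hy (Ne.symm hsf) hyf hys t htf hts
  have hxt : (x t).a = 13 := (R2_shape_levels _ (hxR t)).1 (hu t htf)
  rw [heq t htj] at hxt
  omega

/-- **LEMMA A.** Under the fine door no supported P-cell is an A-hook (floor slot `f` axis, the other three slots units). -/
theorem no_ahook (hD : D.OnAlphabet 14) (hR : Ring2 D) (hdisj : Disj D) (hrule : RuleD D) (hfine : RuleDPFine D)
    {x : Cell} (hx : x ∈ D.suppP) (f : Fin 4) (hA : IsAxFlL (x f)) (hu : ∀ g : Fin 4, g ≠ f → IsUnitL (x g)) : False := by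
  have hxR : ∀ t : Fin 4, x t ∈ R2 := memR2_of_supp hD hR (mem_supp_of_memP D hx)
  by_cases hf3 : f < 3
  · -- block (f, 3): annA on f, e_A* on 3
    have hf3' : f ≠ 3 := ne_of_lt hf3
    have hval : DMassValid x f 3 (annA (x f)) eA :=
      ⟨hf3, Or.inl (detects_floor_first _ (hxR f) _ (hxR 3) hA (hu 3 (Ne.symm hf3')))⟩
    obtain ⟨y, hy, hc⟩ := hfine x hx f 3 _ _ hval
    have hyR : ∀ t : Fin 4, y t ∈ R2 := memR2_of_supp hD hR (mem_supp_of_memN D hy)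
    rcases hc with heq | ⟨hleg, hna⟩ | ⟨hleg, hna⟩ | ⟨hr, hna, -⟩
    · exact hdisj y hy (heq ▸ hx)
    · exact hna (annA_annihilates _ (hxR f) _ (hyR f) hA hleg.1)
    · exact no_raised_hook hD hR hdisj hrule hy hxR hf3' hA hu hleg.2
    · exact hna (annA_annihilates _ (hxR f) _ (hyR f) hA hr.2.1)
  · -- f = 3: block (0, 3): e_A* on 0, annA on 3
    have hf : f = 3 := by
      apply le_antisymm (Fin.le_last f)
      exact not_lt.mp hf3
    subst hf
    have h03 : (0 : Fin 4) ≠ 3 := by decide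
    have hval : DMassValid x 0 3 eA (annA (x 3)) :=
      ⟨by decide, Or.inl (detects_unit_first _ (hxR 0) _ (hxR 3) (hu 0 h03) hA)⟩
    obtain ⟨y, hy, hc⟩ := hfine x hx 0 3 _ _ hval
    have hyR : ∀ t : Fin 4, y t ∈ R2 := memR2_of_supp hD hR (mem_supp_of_memN D hy)
    rcases hc with heq | ⟨hleg, hna⟩ | ⟨hleg, hna⟩ | ⟨hr, -, hnb⟩
    · exact hdisj y hy (heq ▸ hx)
    · exact no_raised_hook hD hR hdisj hrule hy hxR (Ne.symm h03) hA hu hleg.2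
    · exact hna (annA_annihilates _ (hxR 3) _ (hyR 3) hA hleg.1)
    · exact hnb (annA_annihilates _ (hxR 3) _ (hyR 3) hA hr.2.2.1)

/-! ## §4 LEMMA A′ (unit-pair functional): no HOOK of either kind on the P side; no unit⁴ on the N side; the copies floor -/

/-- **LEMMA A′.** Under the fine door, a supported P-cell with two unit slots `g < j`, a floor slot `f` and a non-hub fourth slot `t` cannot
exist: the functional (`annU` on `g`, `e_A*` on `j`) is valid, and its only counted servers are the cell itself (✗ `Disj`) and the `j`-leg
`x[j ↦ ·]`, which agrees with `x` on the floor `f`, the unit `g` and the non-hub `t` — ✗ LAW F3.  In particular NO A-hook and NO B-hook is a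
supported P-cell (B-hook exclusion here needs no (A1), unlike `RingTwoMassLaw.no_bhook_P`). -/
theorem no_hook (hD : D.OnAlphabet 14) (hR : Ring2 D) (hdisj : Disj D) (hrule : RuleD D) (hfine : RuleDPFine D)
    {x : Cell} (hx : x ∈ D.suppP) {g j f t : Fin 4} (hgj : g < j) (hfg : f ≠ g) (hfj : f ≠ j) (htf : t ≠ f) (htg : t ≠ g) (htj : t ≠ j)
    (hug : IsUnitL (x g)) (huj : IsUnitL (x j)) (hf : (x f).a = 12) (ht : (x t).a ≠ 14) : False := by
  have hxR : ∀ s : Fin 4, x s ∈ R2 := memR2_of_supp hD hR (mem_supp_of_memP D hx)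
  have hval : DMassValid x g j (annU (x g)) eA :=
    ⟨hgj, Or.inl (detects_unit_pair _ (hxR g) _ (hxR j) hug huj)⟩
  obtain ⟨y, hy, hc⟩ := hfine x hx g j _ _ hval
  have hyR : ∀ s : Fin 4, y s ∈ R2 := memR2_of_supp hD hR (mem_supp_of_memN D hy)
  rcases hc with heq | ⟨hleg, hna⟩ | ⟨hleg, -⟩ | ⟨hr, hna, -⟩
  · exact hdisj y hy (heq ▸ hx)
  · exact hna (annU_annihilates _ (hxR g) _ (hyR g) hug hleg.1)
  · -- y agrees with x off j: floor on f, unit on g, non-hub on t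
    have ef : x f = y f := hleg.2 f hfj
    have eg : x g = y g := hleg.2 g (ne_of_lt hgj)
    have et : x t = y t := hleg.2 t htj
    have hyf : (y f).a = 12 := by rw [← ef]; exact hf
    have hyg : (y g).a = 13 := by rw [← eg]; exact (R2_shape_levels _ (hxR g)).1 hug
    have hyt : (y t).a = 14 := F3 hD hR hdisj hrule hy hfg hyf hyg t htf htg
    rw [← et] at hyt
    exact ht hyt
  · exact hna (annU_annihilates _ (hxR g) _ (hyR g) hug hr.2.1)

/-- a HOOK (floor letter on slot `f`, units on the three other slots) is not a supported P-cell. -/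
theorem no_hook_at (hD : D.OnAlphabet 14) (hR : Ring2 D) (hdisj : Disj D) (hrule : RuleD D) (hfine : RuleDPFine D)
    {x : Cell} (hx : x ∈ D.suppP) (f : Fin 4) (hf : (x f).a = 12) (hu : ∀ s : Fin 4, s ≠ f → IsUnitL (x s)) : False := by
  have hxR : ∀ s : Fin 4, x s ∈ R2 := memR2_of_supp hD hR (mem_supp_of_memP D hx)
  have hlev : ∀ s : Fin 4, s ≠ f → (x s).a = 13 := fun s hs => (R2_shape_levels _ (hxR s)).1 (hu s hs)
  -- choose the three unit slots g < j and t according to f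
  fin_cases f
  · exact no_hook hD hR hdisj hrule hfine hx (g := 1) (j := 2) (f := 0) (t := 3) (by decide) (by decide) (by decide) (by decide)
      (by decide) (by decide) (hu 1 (by decide)) (hu 2 (by decide)) hf (by rw [hlev 3 (by decide)]; omega)
  · exact no_hook hD hR hdisj hrule hfine hx (g := 0) (j := 2) (f := 1) (t := 3) (by decide) (by decide) (by decide) (by decide)
      (by decide) (by decide) (hu 0 (by decide)) (hu 2 (by decide)) hf (by rw [hlev 3 (by decide)]; omega)
  · exact no_hook hD hR hdisj hrule hfine hx (g := 0) (j := 1) (f := 2) (t := 3) (by decide) (by decide) (by decide) (by decide)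
      (by decide) (by decide) (hu 0 (by decide)) (hu 1 (by decide)) hf (by rw [hlev 3 (by decide)]; omega)
  · exact no_hook hD hR hdisj hrule hfine hx (g := 0) (j := 1) (f := 3) (t := 2) (by decide) (by decide) (by decide) (by decide)
      (by decide) (by decide) (hu 0 (by decide)) (hu 1 (by decide)) hf (by rw [hlev 2 (by decide)]; omega)

/-- **no supported N-cell is unit⁴** behind the fine door (no (A1) needed). -/
theorem noNUnit4_of_fine (hD : D.OnAlphabet 14) (hR : Ring2 D) (hdisj : Disj D) (hrule : RuleD D) (hfine : RuleDPFine D) :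
    NoNUnit4 D := by
  intro y hy
  by_contra hne
  have hall : u4B y = true := by simpa using hne
  have hunit : ∀ f : Fin 4, IsUnitL (y f) := by
    intro f
    unfold u4B at hall
    have := List.all_eq_true.mp hall f (List.mem_finRange f)
    simpa using this
  have hyR : ∀ t : Fin 4, y t ∈ R2 := memR2_of_supp hD hR (mem_supp_of_memN D hy)
  have hlev : ∀ f : Fin 4, (y f).a = 13 := fun f => (R2_shape_levels _ (hyR f)).1 (hunit f)
  have h01 : (0 : Fin 4) ≠ 1 := by decide
  have hdet : Detects y 0 1 := detects_of_ne_14 (hyR 0) (by rw [hlev 0]; omega) 1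
  obtain ⟨x, hx, hs⟩ := supplier_of_N hrule hy h01 hdet
  have hxR : ∀ t : Fin 4, x t ∈ R2 := memR2_of_supp hD hR (mem_supp_of_memP D hx)
  have xunit : ∀ f : Fin 4, x f = y f → IsUnitL (x f) := fun f h => by rw [h]; exact hunit f
  rcases hs.2.1 with e0 | n0 <;> rcases hs.2.2 with e1 | n1
  · exact hdisj y hy ((cell_eq_of_supplies hs e0 e1) ▸ hx)
  · -- slot 1 lowered (a hook with floor slot 1), slot 0 equal
    refine no_hook_at hD hR hdisj hrule hfine hx 1 (null_to_13 (hxR 1) n1 (hlev 1)) ?_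
    intro f hf
    by_cases hf0 : f = 0
    · subst hf0; exact xunit 0 e0
    · exact xunit f (hs.1 f hf0 hf)
  · -- slot 0 lowered, slot 1 equal
    refine no_hook_at hD hR hdisj hrule hfine hx 0 (null_to_13 (hxR 0) n0 (hlev 0)) ?_
    intro f hf
    by_cases hf1 : f = 1
    · subst hf1; exact xunit 1 e1
    · exact xunit f (hs.1 f hf hf1)
  · -- both lowered: two floors on slots 0, 1 and a unit on slot 2 — LAW F2
    have h2 : (x 2).a = 14 := F2 hD hR hdisj hrule hx h01 (null_to_13 (hxR 0) n0 (hlev 0)) (null_to_13 (hxR 1) n1 (hlev 1))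
      2 (by decide) (by decide)
    have e2 : x 2 = y 2 := hs.1 2 (by decide) (by decide)
    rw [e2, hlev 2] at h2
    omega

/-- **FINE-DOOR RING 2 COSTS ≥ 520 COPIES**, modulo the ONE displayed kernel theorem of `RingTwoMassLaw`:
`h520 := regime_noNunit4_hall8U hD hR hdisj hrule h1 hμ hU8` (its `Ring2 ∕ NoNUnit4` have the same texts as ours; composed in
`FineDoorRing2Kernel.lean` once the module builds on the farm). -/
theorem fineDoor_copies_ge_520_of (hD : D.OnAlphabet 14) (hR : Ring2 D) (hdisj : Disj D) (hrule : RuleD D)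
    (hfine : RuleDPFine D) (h520 : NoNUnit4 D → 520 ≤ D.copies) : 520 ≤ D.copies :=
  h520 (noNUnit4_of_fine hD hR hdisj hrule hfine)

/-- **THE OPEN CELL IS EMPTY BEHIND THE FINE DOOR**: no such design has `copies ≤ 108` (the v4.2 door, `SigmaH.copies_le_108_of_budget`);
indeed none has `copies ≤ 519`. -/
theorem fineDoor_empty_le_108_of (hD : D.OnAlphabet 14) (hR : Ring2 D) (hdisj : Disj D) (hrule : RuleD D)
    (hfine : RuleDPFine D) (h520 : NoNUnit4 D → 520 ≤ D.copies) (hB : D.copies ≤ 108) : False := by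
  have := fineDoor_copies_ge_520_of hD hR hdisj hrule hfine h520
  omega

/-- **FINE-DOOR RING 2 COSTS ≥ 520 COPIES — KERNEL, UNCONDITIONAL** (v1.4): every `OnAlphabet 14 ∧ Ring2 ∧ Disj ∧ RuleD ∧ (A1)` design with
`μ ≠ 0`, the Hall surplus row `HallPlusUp · 8` and the fine door `RuleDPFine` has at least 520 copies
(`RingTwoMassLaw.regime_noNunit4_hall8U` ∘ `noNUnit4_of_fine`). -/
theorem fineDoor_copies_ge_520 (hD : D.OnAlphabet 14) (hR : Ring2 D) (hdisj : Disj D) (hrule : RuleD D) (h1 : D.A1)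
    (hfine : RuleDPFine D) (hμ : D.mu ≠ 0) (hU8 : HallPlusUp D 8) : 520 ≤ D.copies :=
  regime_noNunit4_hall8U hD hR hdisj hrule h1 hμ hU8 (noNUnit4_of_fine hD hR hdisj hrule hfine)

/-- without the Hall row: `≥ 400` (`regime_noNunit4U`). -/
theorem fineDoor_copies_ge_400 (hD : D.OnAlphabet 14) (hR : Ring2 D) (hdisj : Disj D) (hrule : RuleD D) (h1 : D.A1)
    (hfine : RuleDPFine D) (hμ : D.mu ≠ 0) : 400 ≤ D.copies :=
  regime_noNunit4U hD hR hdisj hrule h1 hμ (noNUnit4_of_fine hD hR hdisj hrule hfine)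

/-- **THE OPEN CELL OF THE RING LEDGER IS EMPTY BEHIND THE FINE DOOR — KERNEL:** `copies ≤ 519` is impossible; a fortiori `copies ≤ 108`
(the v4.2∕v4.3 door via `SigmaH.copies_le_108_of_budget`) and `copies + rank ≤ 116`. -/
theorem fineDoor_empty_le_519 (hD : D.OnAlphabet 14) (hR : Ring2 D) (hdisj : Disj D) (hrule : RuleD D) (h1 : D.A1)
    (hfine : RuleDPFine D) (hμ : D.mu ≠ 0) (hU8 : HallPlusUp D 8) (hB : D.copies ≤ 519) : False := by
  have := fineDoor_copies_ge_520 hD hR hdisj hrule h1 hfine hμ hU8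
  omega

theorem fineDoor_empty_le_108 (hD : D.OnAlphabet 14) (hR : Ring2 D) (hdisj : Disj D) (hrule : RuleD D) (h1 : D.A1)
    (hfine : RuleDPFine D) (hμ : D.mu ≠ 0) (hU8 : HallPlusUp D 8) (hB : D.copies ≤ 108) : False :=
  fineDoor_empty_le_519 hD hR hdisj hrule h1 hfine hμ hU8 (by omega)

/-- the same with the budget in the door's own form `copies + rank ≤ 116` (`budget_eq_two_Nmass`: `= 2·Σ_N`; `Σ_P ≥ 0`). -/
theorem fineDoor_empty_budget116 (hD : D.OnAlphabet 14) (hR : Ring2 D) (hdisj : Disj D) (hrule : RuleD D) (h1 : D.A1)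
    (hfine : RuleDPFine D) (hμ : D.mu ≠ 0) (hU8 : HallPlusUp D 8) (hB : (D.copies : ℤ) + D.rank ≤ 116) : False := by
  have h520 := fineDoor_copies_ge_520 hD hR hdisj hrule h1 hfine hμ hU8
  have hr : D.rank = ((D.N.map Prod.snd).sum : ℤ) - ((D.P.map Prod.snd).sum : ℤ) := rfl
  have hc : D.copies = (D.N.map Prod.snd).sum + (D.P.map Prod.snd).sum := rfl
  have h8 : (8 : ℤ) ≤ D.rank := RuleDPlate.eight_le_rank_of_hallPlusUp D hU8
    (RingTwoMassLaw.pmass_pos_nat hD hR hdisj hrule h1 (RingTwoMassLaw.parityCoupled_of_A1 hD h1) hμ)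
  omega

end

/-! ## §4b THE LIFT LAW (every shell): behind the fine door a supported P-cell with two unit slots has its single-hub lifts on the N side -/

section
variable {D : Design}

/-- a unit letter of the height-14 alphabet lies in `R2` (no ring hypothesis). -/
theorem unit_mem_R2 {ℓ : Letter} (hℓ : ℓ.OnAlphabet 14) (hu : IsUnitL ℓ) : ℓ ∈ R2 :=
  mem_R2 hℓ (by unfold IsUnitL at hu; omega)

/-- a letter of the height-14 alphabet one null step above a unit is the hub (it lies in `R2` and has level 14). -/
theorem above_unit_mem_R2 {u ℓ : Letter} (hℓ : ℓ.OnAlphabet 14) (hn : NullStep u ℓ) (hu13 : u.a = 13) : ℓ ∈ R2 ∧ ℓ.a = 14 := by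
  have h1 := hℓ.1
  unfold Letter.height at h1
  have hx := abs_nonneg ℓ.x
  have hy := abs_nonneg ℓ.y
  have ha : ℓ.a = 14 := by have := hn.1; omega
  refine ⟨mem_R2 hℓ ?_, ha⟩
  unfold Letter.colevel; omega

/-- **LIFT LAW (P side, every shell of the height-14 alphabet).** Behind the fine door, a supported P-cell `x` with unit letters on two slots
`g < j` has a supported N-cell that agrees with `x` off `j` and sits one null step above `x j` on `j` — on the alphabet: the SINGLE-HUB LIFT
`x[j ↦ H] ∈ suppN` (and symmetrically `x[g ↦ H]`, by `lift_law_fst`).  Only `Disj` and `OnAlphabet` are used — no ring, no (A1), no LAW F. -/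
theorem lift_law (hD : D.OnAlphabet 14) (hdisj : Disj D) (hfine : RuleDPFine D) {x : Cell} (hx : x ∈ D.suppP)
    {g j : Fin 4} (hgj : g < j) (hug : IsUnitL (x g)) (huj : IsUnitL (x j)) :
    ∃ y ∈ D.suppN, (∀ t : Fin 4, t ≠ j → x t = y t) ∧ (y j).a = 14 := by
  have hxA : ∀ s : Fin 4, (x s).OnAlphabet 14 := fun s => hD x (mem_supp_of_memP D hx) s
  have hgR : x g ∈ R2 := unit_mem_R2 (hxA g) hug
  have hjR : x j ∈ R2 := unit_mem_R2 (hxA j) huj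
  have hval : DMassValid x g j (annU (x g)) eA := ⟨hgj, Or.inl (detects_unit_pair _ hgR _ hjR hug huj)⟩
  obtain ⟨y, hy, hc⟩ := hfine x hx g j _ _ hval
  have hyA : ∀ s : Fin 4, (y s).OnAlphabet 14 := fun s => hD y (mem_supp_of_memN D hy) s
  have hg13 : (x g).a = 13 := (R2_shape_levels _ hgR).1 hug
  have hj13 : (x j).a = 13 := (R2_shape_levels _ hjR).1 huj
  rcases hc with heq | ⟨hleg, hna⟩ | ⟨hleg, -⟩ | ⟨hr, hna, -⟩
  · exact (hdisj y hy (heq ▸ hx)).elim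
  · exact (hna (annU_annihilates _ hgR _ (above_unit_mem_R2 (hyA g) hleg.1 hg13).1 hug hleg.1)).elim
  · exact ⟨y, hy, hleg.2, (above_unit_mem_R2 (hyA j) hleg.1 hj13).2⟩
  · exact (hna (annU_annihilates _ hgR _ (above_unit_mem_R2 (hyA g) hr.2.1 hg13).1 hug hr.2.1)).elim

/-- (L5b) validity of the unit-pair functional with the roles swapped (`e_A*` on the first unit slot, `annU` on the second). -/
theorem detects_unit_pair_swap : ∀ u ∈ R2, ∀ u' ∈ R2, IsUnitL u → IsUnitL u' →
    FDetects eA (annU u') !![star u'.beta, intG (u'.a - u.a); 0, -u.beta] := by decide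

/-- **LIFT LAW, first slot:** the same with the lift on the smaller slot `g`. -/
theorem lift_law_fst (hD : D.OnAlphabet 14) (hdisj : Disj D) (hfine : RuleDPFine D) {x : Cell} (hx : x ∈ D.suppP)
    {g j : Fin 4} (hgj : g < j) (hug : IsUnitL (x g)) (huj : IsUnitL (x j)) :
    ∃ y ∈ D.suppN, (∀ t : Fin 4, t ≠ g → x t = y t) ∧ (y g).a = 14 := by
  have hxA : ∀ s : Fin 4, (x s).OnAlphabet 14 := fun s => hD x (mem_supp_of_memP D hx) s
  have hgR : x g ∈ R2 := unit_mem_R2 (hxA g) hug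
  have hjR : x j ∈ R2 := unit_mem_R2 (hxA j) huj
  have hval : DMassValid x g j eA (annU (x j)) := ⟨hgj, Or.inl (detects_unit_pair_swap _ hgR _ hjR hug huj)⟩
  obtain ⟨y, hy, hc⟩ := hfine x hx g j _ _ hval
  have hyA : ∀ s : Fin 4, (y s).OnAlphabet 14 := fun s => hD y (mem_supp_of_memN D hy) s
  have hg13 : (x g).a = 13 := (R2_shape_levels _ hgR).1 hug
  have hj13 : (x j).a = 13 := (R2_shape_levels _ hjR).1 huj
  rcases hc with heq | ⟨hleg, -⟩ | ⟨hleg, hna⟩ | ⟨hr, -, hnb⟩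
  · exact (hdisj y hy (heq ▸ hx)).elim
  · exact ⟨y, hy, hleg.2, (above_unit_mem_R2 (hyA g) hleg.1 hg13).2⟩
  · exact (hna (annU_annihilates _ hjR _ (above_unit_mem_R2 (hyA j) hleg.1 hj13).1 huj hleg.1)).elim
  · exact (hnb (annU_annihilates _ hjR _ (above_unit_mem_R2 (hyA j) hr.2.2.1 hj13).1 huj hr.2.2.1)).elim

end

/-! ## §5 The MASS form of the fine door over `DepthBoundA4.Design` (the rows of record WITH multiplicities; `RuleDPFine` is their support shadow)

THEOREM D-MASS as typed in `C4StabilitySpec` § DMass (`homDim ∕ dmassCapN|P ∕ DMassRowN|P ∕ DMassN|P ∕ DMassAll`) transcribed to `Design`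
(entries `(cell, multiplicity)`, `Design.mN ∕ Design.mP`): for every supported cell, block `g < j` and VALID functional, the multiplicity is at
most the `h⁰`-weighted mass of its COUNTED partners on the other side.  This is the door the director's v4.3 «SPlus-fine» means when later
shells need masses; §1's `RuleDPFine` is exactly its P-side support shadow (`ruleDPFine_of_dmassP`). -/

/-- `kFactor` of one factor difference `up − lo` ASSUMED effective (spec `kFactor`): `1` for `0`; `gcd(Δa, Δx, Δy)` if null; `Δa² − Δx² − Δy²`
if timelike (`h⁰` under the canonical Pic⁰ lift). -/
def kFactor (lo up : Letter) : ℤ :=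
  if up.a - lo.a = 0 ∧ up.x - lo.x = 0 ∧ up.y - lo.y = 0 then 1
  else if (up.x - lo.x) ^ 2 + (up.y - lo.y) ^ 2 = (up.a - lo.a) ^ 2 then (Int.gcd (Int.gcd (up.a - lo.a) (up.x - lo.x)) (up.y - lo.y) : ℤ)
  else (up.a - lo.a) ^ 2 - (up.x - lo.x) ^ 2 - (up.y - lo.y) ^ 2

/-- the effective order on cells: every factor difference is zero or future-causal (spec `MCell.le` ∕ `Effective`). -/
def CellLe (lo up : Cell) : Prop :=
  ∀ f : Fin 4, 0 ≤ (up f).a - (lo f).a ∧ ((up f).x - (lo f).x) ^ 2 + ((up f).y - (lo f).y) ^ 2 ≤ ((up f).a - (lo f).a) ^ 2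

private instance decCellLe (lo up : Cell) : Decidable (CellLe lo up) := by unfold CellLe; infer_instance
private instance decCounts (lo up : Cell) (g j : Fin 4) (l m : Fin 2 → GaussianInt) : Decidable (DMassCounts lo up g j l m) := by
  unfold DMassCounts IsLeg IsR2a; infer_instance

/-- `homDim lo up = dim Hom(L_lo, L_up) = h⁰(L_up ⊗ L_lo⁻¹)` under the canonical lift (spec `homDim`): product of the four `kFactor`s when
`lo ≤ up`, else `0`; the true value under any other Pic⁰ labelling is `≤` this one, so rows using it are the WEAKEST (valid for all labellings). -/
def homDim (lo up : Cell) : ℤ := if CellLe lo up then ∏ f : Fin 4, kFactor (lo f) (up f) else 0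

/-- N-side capacity of the N-cell `ν` for `(g, j; λ, μ)`: `Σ` over the P entries `(p, m)` COUNTED for `ν` of `homDim p ν · m` (spec `dmassCapN`). -/
def capN (D : Design) (ν : Cell) (g j : Fin 4) (l m : Fin 2 → GaussianInt) : ℤ :=
  (D.P.map fun pm => if DMassCounts pm.1 ν g j l m then homDim pm.1 ν * (pm.2 : ℤ) else 0).sum

/-- P-side capacity of the P-cell `π`: `Σ` over the N entries `(y, m)` COUNTED for `π` of `homDim π y · m` (spec `dmassCapP`). -/
def capP (D : Design) (π : Cell) (g j : Fin 4) (l m : Fin 2 → GaussianInt) : ℤ :=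
  (D.N.map fun ym => if DMassCounts π ym.1 g j l m then homDim π ym.1 * (ym.2 : ℤ) else 0).sum

/-- **D-MASS-N rows** (THEOREM P lower level, behind (H2)): `m_N(ν) ≤ capN` for every supported N-cell, block and valid functional. -/
def DMassN (D : Design) : Prop :=
  ∀ ν ∈ D.suppN, ∀ g j : Fin 4, ∀ l m : Fin 2 → GaussianInt, DMassValid ν g j l m → (D.mN ν : ℤ) ≤ capN D ν g j l m

/-- **D-MASS-P rows** (THEOREM P upper level, behind (H2)): `m_P(π) ≤ capP` for every supported P-cell, block and valid functional. -/
def DMassP (D : Design) : Prop :=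
  ∀ π ∈ D.suppP, ∀ g j : Fin 4, ∀ l m : Fin 2 → GaussianInt, DMassValid π g j l m → (D.mP π : ℤ) ≤ capP D π g j l m

/-- **THE FINE DOOR, mass form, both sides** (spec `DMassAll`). -/
def FineDoor (D : Design) : Prop := DMassN D ∧ DMassP D

section
variable {D : Design}

private theorem exists_pos_of_sum_pos {α : Type} (l : List α) (f : α → ℤ) (h : 0 < (l.map f).sum) : ∃ a ∈ l, 0 < f a := by
  induction l with
  | nil => simp at h
  | cons a t ih =>
    simp only [List.map_cons, List.sum_cons] at h
    by_cases ha : 0 < f a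
    · exact ⟨a, List.mem_cons_self, ha⟩
    · obtain ⟨b, hb, hpos⟩ := ih (by omega)
      exact ⟨b, List.mem_cons_of_mem a hb, hpos⟩

/-- **the P-side support shadow:** the mass rows imply `RuleDPFine` (a positive mass has a counted server of positive mass). -/
theorem ruleDPFine_of_dmassP (h : DMassP D) : RuleDPFine D := by
  intro x hx g j l m hval
  have hm : 0 < D.mP x := (mem_suppP_iff_mP_pos D x).mp hx
  have hrow := h x hx g j l m hval
  have hcap : 0 < capP D x g j l m := by
    have : (0 : ℤ) < (D.mP x : ℤ) := by exact_mod_cast hm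
    omega
  obtain ⟨ym, hmem, hpos⟩ := exists_pos_of_sum_pos D.N _ hcap
  have hc : DMassCounts x ym.1 g j l m := by
    by_contra hnc
    simp [hnc] at hpos
  have hmpos : 0 < ym.2 := by
    by_contra h0
    have h0' : ym.2 = 0 := by omega
    simp [hc, h0'] at hpos
  have hy : ym.1 ∈ D.suppN := (mem_suppN_iff D ym.1).mpr ⟨ym.2, by simpa using hmem, hmpos⟩
  exact ⟨ym.1, hy, hc⟩

/-- so every consequence of `RuleDPFine` in this file holds behind the mass-form fine door. -/
theorem noNUnit4_of_fineDoor (hD : D.OnAlphabet 14) (hR : Ring2 D) (hdisj : Disj D) (hrule : RuleD D) (hfine : FineDoor D) :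
    NoNUnit4 D :=
  noNUnit4_of_fine hD hR hdisj hrule (ruleDPFine_of_dmassP hfine.2)

end

/-! ## §6 FINE SHELL 3 (director R19.685 (2)): behind the fine door the CHARGED N-cells of shell 3 have the ring-2 shapes `u⁴ ∕ (A;u,u,u) ∕ (B;u,u,u)`

Shell 3 = `DeepLayerLaws.RingLe 3` (co-level ≤ 3: hub `H`, units `u`, mid axis `A`, mid diagonal `B`, deep axis `C = (11;±3,0),(11;0,±3)`,
deep off-axis `D = (11;±2,±1),(11;±1,±2)` at height 14).  COARSE input (strengthen g17 `RingThreeAnatomy`, one-liners from `DeepLayerLaws` §6c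
= THE SUM RULE at `c = 3`, re-derived here because `RingThreeAnatomy` is not built on the farm): N deep+mid ⇒ the other two slots are hubs; N two
mids ⇒ the other two are axis; P two deep ⇒ the other two are hubs.  FINE input: the LIFT LAWS (§4b and the `A`-slot variants below).
MACHINE COUNTERPART: the fine-pruned room `room3-fine-compact.json` 8940f2df8ed13676 (charged N orbits 140 → 31 = {u⁴ 8, Auuu 13, Buuu 10}),
reproduced cell for cell by gs-eng-2 g64 and check-static-1 g12.  Height 14 only (the alphabet lists `R2 ∕ R3` are height-14 lists). -/

/-- the 25 letters of the height-14 alphabet of co-level `≤ 3`. -/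
def R3 : List Letter :=
  [⟨14, 0, 0⟩, ⟨13, 1, 0⟩, ⟨13, -1, 0⟩, ⟨13, 0, 1⟩, ⟨13, 0, -1⟩,
   ⟨12, 2, 0⟩, ⟨12, -2, 0⟩, ⟨12, 0, 2⟩, ⟨12, 0, -2⟩, ⟨12, 1, 1⟩, ⟨12, 1, -1⟩, ⟨12, -1, 1⟩, ⟨12, -1, -1⟩,
   ⟨11, 3, 0⟩, ⟨11, -3, 0⟩, ⟨11, 0, 3⟩, ⟨11, 0, -3⟩,
   ⟨11, 2, 1⟩, ⟨11, 2, -1⟩, ⟨11, -2, 1⟩, ⟨11, -2, -1⟩, ⟨11, 1, 2⟩, ⟨11, 1, -2⟩, ⟨11, -1, 2⟩, ⟨11, -1, -2⟩]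

theorem mem_R3 {ℓ : Letter} (hℓ : ℓ.OnAlphabet 14) (hc : ℓ.colevel ≤ 3) : ℓ ∈ R3 := by
  obtain ⟨a, x, y⟩ := ℓ
  have h1 := hℓ.1
  simp only [Letter.height, Letter.colevel] at h1 hc
  have hx := abs_nonneg x
  have hy := abs_nonneg y
  have hxb : -3 ≤ x ∧ x ≤ 3 := abs_le.mp (by linarith)
  have hyb : -3 ≤ y ∧ y ≤ 3 := abs_le.mp (by linarith)
  obtain rfl : a = 14 - |x| - |y| := by linarith
  obtain ⟨hx1, hx2⟩ := hxb
  obtain ⟨hy1, hy2⟩ := hyb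
  interval_cases x <;> interval_cases y <;> first | decide | (norm_num at hc)

section
variable {D : Design}

theorem memR3_of_supp (hD : D.OnAlphabet 14) (hR : RingLe 3 D) {c : Cell} (hc : c ∈ D.suppN ++ D.suppP) (f : Fin 4) : c f ∈ R3 :=
  mem_R3 (hD c hc f) (hR c hc f)

/-! ### letter facts on the shell-3 alphabet (all `decide`) -/

/-- below a unit: a mid or a deep letter; below a mid axis `A`: deep; below a mid diagonal `B`: deep off-axis; below a deep letter: nothing. -/
theorem below_unit3 : ∀ u ∈ R3, ∀ ℓ ∈ R3, IsUnitL u → NullStep ℓ u → ℓ.colevel = 2 ∨ ℓ.colevel = 3 := by decide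
theorem below_A3 : ∀ A ∈ R3, ∀ ℓ ∈ R3, IsAxFlL A → NullStep ℓ A → ℓ.colevel = 3 := by decide
theorem below_B3 : ∀ B ∈ R3, ∀ ℓ ∈ R3, IsDiagL B → NullStep ℓ B → ℓ.colevel = 3 := by decide
theorem below_deep3 : ∀ d ∈ R3, ∀ ℓ ∈ R3, d.colevel = 3 → NullStep ℓ d → False := by decide
/-- above a mid axis `A`: a unit or the hub. -/
theorem above_A3 : ∀ A ∈ R3, ∀ ℓ ∈ R3, IsAxFlL A → NullStep A ℓ → ℓ.colevel ≤ 1 := by decide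

/-- validity of (`annA` on an `A` slot, `e_A*` on an `A` slot): value `−β_A · conj β_A′ ≠ 0`. -/
theorem detects_floor_floor : ∀ A ∈ R2, ∀ A' ∈ R2, IsAxFlL A → IsAxFlL A' →
    FDetects (annA A) eA !![star A'.beta, intG (A'.a - A.a); 0, -A.beta] := by decide
theorem detects_floor_floor_swap : ∀ A' ∈ R2, ∀ A ∈ R2, IsAxFlL A' → IsAxFlL A →
    FDetects eA (annA A) !![star A.beta, intG (A.a - A'.a); 0, -A'.beta] := by decide

/-- a letter of the height-14 alphabet one null step above a mid axis letter lies in `R2` and has co-level `≤ 1`. -/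
theorem above_floor_mem_R2 {A ℓ : Letter} (hℓ : ℓ.OnAlphabet 14) (hn : NullStep A ℓ) (hA12 : A.a = 12) : ℓ ∈ R2 ∧ ℓ.colevel ≤ 1 := by
  have h1 := hℓ.1
  unfold Letter.height at h1
  have hx := abs_nonneg ℓ.x
  have hy := abs_nonneg ℓ.y
  have ha : 13 ≤ ℓ.a := by have := hn.1; omega
  have hc : ℓ.colevel ≤ 1 := by unfold Letter.colevel; omega
  exact ⟨mem_R2 hℓ (by omega), hc⟩

/-- a mid axis letter of the height-14 alphabet lies in `R2`. -/
theorem axfl_mem_R2 {ℓ : Letter} (hℓ : ℓ.OnAlphabet 14) (hA : IsAxFlL ℓ) : ℓ ∈ R2 := mem_R2 hℓ (by have := hA.1; omega)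

/-! ### LIFT LAWS from a mid axis slot (every shell; `OnAlphabet 14 ∧ Disj ∧ RuleDPFine` only) -/

/-- **A-LIFT to a unit slot:** `x ∈ suppP` with a mid axis letter on `g` and a unit on `j` ⇒ `x[j ↦ H] ∈ suppN`. -/
theorem liftA_unit (hD : D.OnAlphabet 14) (hdisj : Disj D) (hfine : RuleDPFine D) {x : Cell} (hx : x ∈ D.suppP)
    {g j : Fin 4} (hgj : g ≠ j) (hA : IsAxFlL (x g)) (huj : IsUnitL (x j)) :
    ∃ y ∈ D.suppN, (∀ t : Fin 4, t ≠ j → x t = y t) ∧ (y j).a = 14 := by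
  have hxA : ∀ s : Fin 4, (x s).OnAlphabet 14 := fun s => hD x (mem_supp_of_memP D hx) s
  have hgR : x g ∈ R2 := axfl_mem_R2 (hxA g) hA
  have hjR : x j ∈ R2 := unit_mem_R2 (hxA j) huj
  have hg12 : (x g).a = 12 := (R2_shape_levels _ hgR).2.1 hA
  have hj13 : (x j).a = 13 := (R2_shape_levels _ hjR).1 huj
  rcases lt_or_gt_of_ne hgj with hlt | hlt
  · have hval : DMassValid x g j (annA (x g)) eA := ⟨hlt, Or.inl (detects_floor_first _ hgR _ hjR hA huj)⟩
    obtain ⟨y, hy, hc⟩ := hfine x hx g j _ _ hval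
    have hyA : ∀ s : Fin 4, (y s).OnAlphabet 14 := fun s => hD y (mem_supp_of_memN D hy) s
    rcases hc with heq | ⟨hleg, hna⟩ | ⟨hleg, -⟩ | ⟨hr, hna, -⟩
    · exact (hdisj y hy (heq ▸ hx)).elim
    · exact (hna (annA_annihilates _ hgR _ (above_floor_mem_R2 (hyA g) hleg.1 hg12).1 hA hleg.1)).elim
    · exact ⟨y, hy, hleg.2, (above_unit_mem_R2 (hyA j) hleg.1 hj13).2⟩
    · exact (hna (annA_annihilates _ hgR _ (above_floor_mem_R2 (hyA g) hr.2.1 hg12).1 hA hr.2.1)).elim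
  · have hval : DMassValid x j g eA (annA (x g)) := ⟨hlt, Or.inl (detects_unit_first _ hjR _ hgR huj hA)⟩
    obtain ⟨y, hy, hc⟩ := hfine x hx j g _ _ hval
    have hyA : ∀ s : Fin 4, (y s).OnAlphabet 14 := fun s => hD y (mem_supp_of_memN D hy) s
    rcases hc with heq | ⟨hleg, -⟩ | ⟨hleg, hna⟩ | ⟨hr, -, hnb⟩
    · exact (hdisj y hy (heq ▸ hx)).elim
    · exact ⟨y, hy, hleg.2, (above_unit_mem_R2 (hyA j) hleg.1 hj13).2⟩
    · exact (hna (annA_annihilates _ hgR _ (above_floor_mem_R2 (hyA g) hleg.1 hg12).1 hA hleg.1)).elim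
    · exact (hnb (annA_annihilates _ hgR _ (above_floor_mem_R2 (hyA g) hr.2.2.1 hg12).1 hA hr.2.2.1)).elim

/-- **A-LIFT to another mid axis slot:** `x ∈ suppP` with mid axis letters on `g ≠ j` ⇒ some `x[j ↦ ℓ′] ∈ suppN` with `ℓ′` a null step above `x j`
(on the alphabet: a unit or the hub, `above_A3`). -/
theorem liftA_A (hD : D.OnAlphabet 14) (hdisj : Disj D) (hfine : RuleDPFine D) {x : Cell} (hx : x ∈ D.suppP)
    {g j : Fin 4} (hgj : g ≠ j) (hA : IsAxFlL (x g)) (hAj : IsAxFlL (x j)) :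
    ∃ y ∈ D.suppN, (∀ t : Fin 4, t ≠ j → x t = y t) ∧ NullStep (x j) (y j) := by
  have hxA : ∀ s : Fin 4, (x s).OnAlphabet 14 := fun s => hD x (mem_supp_of_memP D hx) s
  have hgR : x g ∈ R2 := axfl_mem_R2 (hxA g) hA
  have hjR : x j ∈ R2 := axfl_mem_R2 (hxA j) hAj
  have hg12 : (x g).a = 12 := (R2_shape_levels _ hgR).2.1 hA
  rcases lt_or_gt_of_ne hgj with hlt | hlt
  · have hval : DMassValid x g j (annA (x g)) eA := ⟨hlt, Or.inl (detects_floor_floor _ hgR _ hjR hA hAj)⟩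
    obtain ⟨y, hy, hc⟩ := hfine x hx g j _ _ hval
    have hyA : ∀ s : Fin 4, (y s).OnAlphabet 14 := fun s => hD y (mem_supp_of_memN D hy) s
    rcases hc with heq | ⟨hleg, hna⟩ | ⟨hleg, -⟩ | ⟨hr, hna, -⟩
    · exact (hdisj y hy (heq ▸ hx)).elim
    · exact (hna (annA_annihilates _ hgR _ (above_floor_mem_R2 (hyA g) hleg.1 hg12).1 hA hleg.1)).elim
    · exact ⟨y, hy, hleg.2, hleg.1⟩
    · exact (hna (annA_annihilates _ hgR _ (above_floor_mem_R2 (hyA g) hr.2.1 hg12).1 hA hr.2.1)).elim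
  · have hval : DMassValid x j g eA (annA (x g)) := ⟨hlt, Or.inl (detects_floor_floor_swap _ hjR _ hgR hAj hA)⟩
    obtain ⟨y, hy, hc⟩ := hfine x hx j g _ _ hval
    have hyA : ∀ s : Fin 4, (y s).OnAlphabet 14 := fun s => hD y (mem_supp_of_memN D hy) s
    rcases hc with heq | ⟨hleg, -⟩ | ⟨hleg, hna⟩ | ⟨hr, -, hnb⟩
    · exact (hdisj y hy (heq ▸ hx)).elim
    · exact ⟨y, hy, hleg.2, hleg.1⟩
    · exact (hna (annA_annihilates _ hgR _ (above_floor_mem_R2 (hyA g) hleg.1 hg12).1 hA hleg.1)).elim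
    · exact (hnb (annA_annihilates _ hgR _ (above_floor_mem_R2 (hyA g) hr.2.2.1 hg12).1 hA hr.2.2.1)).elim

/-! ### the three COARSE slot laws of shell 3 used here (strengthen g17 `RingThreeAnatomy`, verbatim one-liners from `DeepLayerLaws` §6c) -/

/-- N: a deep letter and a mid letter force the two other slots to be hubs (`RingThreeAnatomy.r3N_deep_mid_hub`). -/
theorem r3N_deep_mid_hub (hA : D.OnAlphabet 14) (hdis : Disj D) (hr : RuleD D) (hR : RingLe 3 D) {y : Cell} (hy : y ∈ D.suppN)
    {g j s : Fin 4} (hgj : g ≠ j) (hsg : s ≠ g) (hsj : s ≠ j) (hg : (y g).colevel = 3) (hj : (y j).colevel = 2) :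
    y s = Letter.hub 14 :=
  sum_rule_N_hub hA hdis hr hR (by norm_num) hy hgj hsg hsj (by rw [hg, hj]; norm_num)

/-- N: two mid letters force the two other slots to be axis (`RingThreeAnatomy.r3N_two_mid`, first half). -/
theorem r3N_two_mid_axis (hA : D.OnAlphabet 14) (hdis : Disj D) (hr : RuleD D) (hR : RingLe 3 D) {y : Cell} (hy : y ∈ D.suppN)
    {g j s : Fin 4} (hgj : g ≠ j) (hsg : s ≠ g) (hsj : s ≠ j) (hg : (y g).colevel = 2) (hj : (y j).colevel = 2) :
    (y s).x * (y s).y = 0 :=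
  sum_rule_N_axis hA hdis hr hR (by norm_num) hy hgj hsg hsj (by rw [hg, hj]; norm_num)

/-- P: two deep letters force the two other slots to be hubs (`RingThreeAnatomy.r3P_two_deep_hub`). -/
theorem r3P_two_deep_hub (hA : D.OnAlphabet 14) (hdis : Disj D) (hr : RuleD D) (hR : RingLe 3 D) {x : Cell} (hx : x ∈ D.suppP)
    {g j s : Fin 4} (hgj : g ≠ j) (hsg : s ≠ g) (hsj : s ≠ j) (hg : (x g).colevel = 3) (hj : (x j).colevel = 3) :
    x s = Letter.hub 14 :=
  sum_rule_P_hub hA hdis hr hR (by norm_num) hx hgj hsg hsj (by rw [hg, hj]; norm_num)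

/-- convenience: a slot equal to the hub has co-level 0. -/
theorem colevel_of_eq_hub {c : Cell} {s : Fin 4} (h : c s = Letter.hub 14) : (c s).colevel = 0 := by rw [h, colevel_hub]

/-! ### the fine deaths on shell 3 -/

/-- **(P, fine) a supported P-cell with a deep slot `d`, a mid slot `m` and two unit slots `u₁ < u₂` is impossible**
(shapes `ACuu ∕ ADuu ∕ BCuu ∕ BDuu`: the unit-pair lift `x[u₂ ↦ H]` would be an N-cell with deep + mid and a unit, ✗ `r3N_deep_mid_hub`). -/
theorem noP_deep_mid_unit_unit (hD : D.OnAlphabet 14) (hR : RingLe 3 D) (hdisj : Disj D) (hrule : RuleD D) (hfine : RuleDPFine D)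
    {x : Cell} (hx : x ∈ D.suppP) {d m u₁ u₂ : Fin 4} (hdm : d ≠ m) (hdu1 : d ≠ u₁) (hdu2 : d ≠ u₂) (hmu1 : m ≠ u₁) (hmu2 : m ≠ u₂)
    (hu : u₁ < u₂) (hd : (x d).colevel = 3) (hm : (x m).colevel = 2) (h1 : IsUnitL (x u₁)) (h2 : IsUnitL (x u₂)) : False := by
  obtain ⟨y, hy, heq, -⟩ := lift_law hD hdisj hfine hx hu h1 h2
  have hyd : (y d).colevel = 3 := by rw [← heq d hdu2]; exact hd
  have hym : (y m).colevel = 2 := by rw [← heq m hmu2]; exact hm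
  have hyu : (y u₁).colevel = 0 := colevel_of_eq_hub (r3N_deep_mid_hub hD hdisj hrule hR hy hdm (Ne.symm hdu1) (Ne.symm hmu1) hyd hym)
  have : (x u₁).colevel = 1 := h1
  rw [heq u₁ (ne_of_lt hu)] at this
  omega

/-- **(P, fine) a supported P-cell with a deep slot, a mid AXIS slot `a`, another mid slot `m` and a unit slot is impossible**
(shapes `AACu ∕ AADu ∕ ABCu ∕ ABDu`: the A-lift `x[u ↦ H]` would be an N-cell with deep + mid `a` and the non-hub `m`, ✗ `r3N_deep_mid_hub`). -/
theorem noP_deep_A_mid_unit (hD : D.OnAlphabet 14) (hR : RingLe 3 D) (hdisj : Disj D) (hrule : RuleD D) (hfine : RuleDPFine D)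
    {x : Cell} (hx : x ∈ D.suppP) {d a m u : Fin 4} (hda : d ≠ a) (hdm : d ≠ m) (hdu : d ≠ u) (ham : a ≠ m) (hau : a ≠ u) (hmu : m ≠ u)
    (hd : (x d).colevel = 3) (hA : IsAxFlL (x a)) (hm : (x m).colevel = 2) (h1 : IsUnitL (x u)) : False := by
  obtain ⟨y, hy, heq, -⟩ := liftA_unit hD hdisj hfine hx hau hA h1
  have hyd : (y d).colevel = 3 := by rw [← heq d hdu]; exact hd
  have hya : (y a).colevel = 2 := by rw [← heq a hau]; exact hA.1
  have hym : (y m).colevel = 0 := colevel_of_eq_hub (r3N_deep_mid_hub hD hdisj hrule hR hy hda (Ne.symm hdm) (Ne.symm ham) hyd hya)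
  rw [← heq m hmu] at hym
  omega

/-- **(P, fine) a supported P-cell with a deep slot and three mid AXIS slots is impossible** (shapes `AAAC ∕ AAAD`: the A-to-A lift raises one `A` to a
unit or the hub; the lift is an N-cell with deep + mid and a non-hub third slot, ✗ `r3N_deep_mid_hub`). -/
theorem noP_deep_AAA (hD : D.OnAlphabet 14) (hR : RingLe 3 D) (hdisj : Disj D) (hrule : RuleD D) (hfine : RuleDPFine D)
    {x : Cell} (hx : x ∈ D.suppP) {d a₁ a₂ a₃ : Fin 4} (hd1 : d ≠ a₁) (hd2 : d ≠ a₂) (hd3 : d ≠ a₃) (h12 : a₁ ≠ a₂) (h13 : a₁ ≠ a₃)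
    (h23 : a₂ ≠ a₃) (hd : (x d).colevel = 3) (hA1 : IsAxFlL (x a₁)) (hA2 : IsAxFlL (x a₂)) (hA3 : IsAxFlL (x a₃)) : False := by
  obtain ⟨y, hy, heq, -⟩ := liftA_A hD hdisj hfine hx h13 hA1 hA3
  have hyd : (y d).colevel = 3 := by rw [← heq d hd3]; exact hd
  have hy1 : (y a₁).colevel = 2 := by rw [← heq a₁ h13]; exact hA1.1
  have hy2 : (y a₂).colevel = 0 := colevel_of_eq_hub (r3N_deep_mid_hub hD hdisj hrule hR hy hd1 (Ne.symm hd2) (Ne.symm h12) hyd hy1)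
  rw [← heq a₂ h23] at hy2
  have := hA2.1
  omega

/-- **(N, fine) no supported N-cell has a DEEP slot next to THREE CHARGED slots one of which is a unit** — in particular the charged shapes
`Cuuu ∕ Duuu` are dead: at the block (deep, unit) every coarse supplier is a P-cell of shape (deep, mid∕deep, ·, ·) killed above. -/
theorem noN_deep_unit_charged (hD : D.OnAlphabet 14) (hR : RingLe 3 D) (hdisj : Disj D) (hrule : RuleD D) (hfine : RuleDPFine D)
    {y : Cell} (hy : y ∈ D.suppN) {d u s t : Fin 4} (hdu : d ≠ u) (hds : d ≠ s) (hdt : d ≠ t) (hus : u ≠ s) (hut : u ≠ t) (hst : s < t)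
    (hd : (y d).colevel = 3) (hu : IsUnitL (y u)) (hs : IsUnitL (y s)) (ht : IsUnitL (y t)) : False := by
  have hyR : ∀ f : Fin 4, y f ∈ R3 := memR3_of_supp hD hR (mem_supp_of_memN D hy)
  have hyR2u : y u ∈ R2 := unit_mem_R2 (hD y (mem_supp_of_memN D hy) u) hu
  have hdet : Detects y d u := detects_symm (detects_of_ne_14 hyR2u (by rw [(R2_shape_levels _ hyR2u).1 hu]; omega) d)
  obtain ⟨x, hx, hsup⟩ := supplier_of_N hrule hy hdu hdet
  have hxR : ∀ f : Fin 4, x f ∈ R3 := memR3_of_supp hD hR (mem_supp_of_memP D hx)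
  -- on the deep slot the supplier is equal (nothing below a deep letter)
  have exd : x d = y d := by
    rcases hsup.2.1 with h | h
    · exact h
    · exact (below_deep3 _ (hyR d) _ (hxR d) hd h).elim
  have hxd : (x d).colevel = 3 := by rw [exd]; exact hd
  have exs : x s = y s := hsup.1 s hds.symm hus.symm
  have ext : x t = y t := hsup.1 t hdt.symm hut.symm
  have hxs : IsUnitL (x s) := by rw [exs]; exact hs
  have hxt : IsUnitL (x t) := by rw [ext]; exact ht
  rcases hsup.2.2 with h | h
  · exact hdisj y hy ((cell_eq_of_supplies hsup exd h) ▸ hx)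
  · rcases below_unit3 _ (hyR u) _ (hxR u) hu h with hm | hdd
    · -- (deep, mid, u, u): fine-dead
      exact noP_deep_mid_unit_unit hD hR hdisj hrule hfine hx hdu hds hdt hus hut hst hxd hm hxs hxt
    · -- (deep, deep, u, u): coarse-dead
      have e := r3P_two_deep_hub hD hdisj hrule hR hx hdu hds.symm hus.symm hxd hdd
      have := colevel_of_eq_hub e
      have h1 : (x s).colevel = 1 := hxs
      omega

/-- **(N, fine) no supported N-cell has two mid AXIS slots and two further CHARGED slots that are units or mid axis** — the charged shapes
`AAAA ∕ AAAu ∕ AAuu` are dead: at the block (A, A′) every coarse supplier lowers an `A` to a deep letter and is killed above. -/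
theorem noN_AA_charged (hD : D.OnAlphabet 14) (hR : RingLe 3 D) (hdisj : Disj D) (hrule : RuleD D) (hfine : RuleDPFine D)
    {y : Cell} (hy : y ∈ D.suppN) {a₁ a₂ s t : Fin 4} (h12 : a₁ ≠ a₂) (h1s : a₁ ≠ s) (h1t : a₁ ≠ t) (h2s : a₂ ≠ s) (h2t : a₂ ≠ t) (hst : s < t)
    (hA1 : IsAxFlL (y a₁)) (hA2 : IsAxFlL (y a₂))
    (hs : IsUnitL (y s) ∨ IsAxFlL (y s)) (ht : IsUnitL (y t) ∨ IsAxFlL (y t)) : False := by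
  have hyR : ∀ f : Fin 4, y f ∈ R3 := memR3_of_supp hD hR (mem_supp_of_memN D hy)
  have hyR2 : y a₁ ∈ R2 := axfl_mem_R2 (hD y (mem_supp_of_memN D hy) a₁) hA1
  have hdet : Detects y a₁ a₂ := detects_of_ne_14 hyR2 (by rw [(R2_shape_levels _ hyR2).2.1 hA1]; omega) a₂
  obtain ⟨x, hx, hsup⟩ := supplier_of_N hrule hy h12 hdet
  have hxR : ∀ f : Fin 4, x f ∈ R3 := memR3_of_supp hD hR (mem_supp_of_memP D hx)
  have exs : x s = y s := hsup.1 s h1s.symm h2s.symm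
  have ext : x t = y t := hsup.1 t h1t.symm h2t.symm
  have hxs : IsUnitL (x s) ∨ IsAxFlL (x s) := by rw [exs]; exact hs
  have hxt : IsUnitL (x t) ∨ IsAxFlL (x t) := by rw [ext]; exact ht
  -- a supplier with a deep letter at `p` and the mid axis letter kept at `q` is fine-dead, whatever the charged kinds of s, t
  have key : ∀ {p q : Fin 4}, p ≠ q → p ≠ s → p ≠ t → q ≠ s → q ≠ t → (x p).colevel = 3 → IsAxFlL (x q) → False := by
    intro p q hpq hps hpt hqs hqt hxp hxq
    rcases hxs with hsu | hsA <;> rcases hxt with htu | htA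
    · exact noP_deep_mid_unit_unit hD hR hdisj hrule hfine hx hpq hps hpt hqs hqt hst hxp hxq.1 hsu htu
    · exact noP_deep_A_mid_unit hD hR hdisj hrule hfine hx hpt hpq hps hqt.symm (ne_of_lt hst).symm hqs hxp htA hxq.1 hsu
    · exact noP_deep_A_mid_unit hD hR hdisj hrule hfine hx hps hpq hpt hqs.symm (ne_of_lt hst) hqt hxp hsA hxq.1 htu
    · exact noP_deep_AAA hD hR hdisj hrule hfine hx hpq hps hpt hqs hqt (ne_of_lt hst) hxp hxq hsA htA
  rcases hsup.2.1 with e1 | n1 <;> rcases hsup.2.2 with e2 | n2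
  · exact hdisj y hy ((cell_eq_of_supplies hsup e1 e2) ▸ hx)
  · exact key h12.symm h2s h2t h1s h1t (below_A3 _ (hyR a₂) _ (hxR a₂) hA2 n2) (by rw [e1]; exact hA1)
  · exact key h12 h1s h1t h2s h2t (below_A3 _ (hyR a₁) _ (hxR a₁) hA1 n1) (by rw [e2]; exact hA2)
  · -- both lowered: two deep ⇒ hubs, but s is charged
    have e := r3P_two_deep_hub hD hdisj hrule hR hx h12 h1s.symm h2s.symm
      (below_A3 _ (hyR a₁) _ (hxR a₁) hA1 n1) (below_A3 _ (hyR a₂) _ (hxR a₂) hA2 n2)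
    have h0 := colevel_of_eq_hub e
    rcases hxs with hsu | hsA
    · have : (x s).colevel = 1 := hsu; omega
    · have := hsA.1; omega

/-- **(N, fine) no supported N-cell has a mid slot `m`, a mid DIAGONAL slot `b ≠ m` and two unit slots** — the charged shapes `ABuu ∕ BBuu` are
dead: at the block (m, b) every coarse supplier has a deep letter under `m` or `b` and is killed above. -/
theorem noN_mid_B_unit_unit (hD : D.OnAlphabet 14) (hR : RingLe 3 D) (hdisj : Disj D) (hrule : RuleD D) (hfine : RuleDPFine D)
    {y : Cell} (hy : y ∈ D.suppN) {m b s t : Fin 4} (hmb : m ≠ b) (hms : m ≠ s) (hmt : m ≠ t) (hbs : b ≠ s) (hbt : b ≠ t) (hst : s < t)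
    (hm : (y m).colevel = 2) (hB : IsDiagL (y b)) (hs : IsUnitL (y s)) (ht : IsUnitL (y t)) : False := by
  have hyR : ∀ f : Fin 4, y f ∈ R3 := memR3_of_supp hD hR (mem_supp_of_memN D hy)
  have hyR2 : y b ∈ R2 := mem_R2 (hD y (mem_supp_of_memN D hy) b) (by have := hB.1; omega)
  have hdet : Detects y b m := detects_of_ne_14 hyR2 (by rw [(R2_shape_levels _ hyR2).2.2.1 hB]; omega) m
  obtain ⟨x, hx, hsup⟩ := supplier_of_N hrule hy hmb.symm hdet
  have hxR : ∀ f : Fin 4, x f ∈ R3 := memR3_of_supp hD hR (mem_supp_of_memP D hx)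
  have exs : x s = y s := hsup.1 s hbs.symm hms.symm
  have ext : x t = y t := hsup.1 t hbt.symm hmt.symm
  have hxs : IsUnitL (x s) := by rw [exs]; exact hs
  have hxt : IsUnitL (x t) := by rw [ext]; exact ht
  -- levels of the two block slots of x: equal (co-level 2) or lowered (deep)
  have hb' : (x b).colevel = 2 ∨ (x b).colevel = 3 := by
    rcases hsup.2.1 with e | n
    · left; rw [e]; exact hB.1
    · right; exact below_B3 _ (hyR b) _ (hxR b) hB n
  have hm' : (x m).colevel = 2 ∨ (x m).colevel = 3 := by
    rcases hsup.2.2 with e | n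
    · left; rw [e]; exact hm
    · right
      have hmR2 : y m ∈ R2 := mem_R2 (hD y (mem_supp_of_memN D hy) m) (by omega)
      rcases (R2_shape_levels _ hmR2).2.2.2 (by
          have h1 := (hD y (mem_supp_of_memN D hy) m).1; unfold Letter.height at h1; unfold Letter.colevel at hm; omega) with hAm | hBm
      · exact below_A3 _ (hyR m) _ (hxR m) hAm n
      · exact below_B3 _ (hyR m) _ (hxR m) hBm n
  rcases hb' with hb2 | hb3 <;> rcases hm' with hm2 | hm3
  · -- both equal ⇒ x = y
    rcases hsup.2.1 with e1 | n1
    · rcases hsup.2.2 with e2 | n2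
      · exact hdisj y hy ((cell_eq_of_supplies hsup e1 e2) ▸ hx)
      · -- unreachable: a null step lowers the co-level
        have h3 : (x m).colevel = 3 := by
          have hmR2 : y m ∈ R2 := mem_R2 (hD y (mem_supp_of_memN D hy) m) (by omega)
          rcases (R2_shape_levels _ hmR2).2.2.2 (by
              have h1 := (hD y (mem_supp_of_memN D hy) m).1; unfold Letter.height at h1; unfold Letter.colevel at hm; omega) with hAm | hBm
          · exact below_A3 _ (hyR m) _ (hxR m) hAm n2
          · exact below_B3 _ (hyR m) _ (hxR m) hBm n2
        omega
    · have h3 : (x b).colevel = 3 := below_B3 _ (hyR b) _ (hxR b) hB n1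
      omega
  · exact noP_deep_mid_unit_unit hD hR hdisj hrule hfine hx hmb hms hmt hbs hbt hst hm3 hb2 hxs hxt
  · exact noP_deep_mid_unit_unit hD hR hdisj hrule hfine hx hmb.symm hbs hbt hms hmt hst hb3 hm2 hxs hxt
  · have e := r3P_two_deep_hub hD hdisj hrule hR hx hmb.symm hbs.symm hms.symm hb3 hm3
    have h0 := colevel_of_eq_hub e
    have h1 : (x s).colevel = 1 := hxs
    omega

/-- **THE FINE SHELL-3 N-LIST (director R19.685 (2)).**  Behind the fine door, a supported N-cell of shell 3 with NO hub letter has one of the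
three ring-2 charged shapes: all four slots units (`u⁴`), or exactly one mid letter (axis `A` or diagonal `B`) and three units
(`(A;u,u,u) ∕ (B;u,u,u)`).  Stated slot-wise: no deep letter, and at most one non-unit slot. -/
theorem charged_N_fine_ring3 (hD : D.OnAlphabet 14) (hR : RingLe 3 D) (hdisj : Disj D) (hrule : RuleD D) (hfine : RuleDPFine D)
    {y : Cell} (hy : y ∈ D.suppN) (hch : ∀ f : Fin 4, (y f).colevel ≠ 0) :
    (∀ f : Fin 4, (y f).colevel ≠ 3) ∧ (∀ f g : Fin 4, f ≠ g → (y f).colevel = 2 → (y g).colevel = 2 → False) := by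
  have hyR : ∀ f : Fin 4, y f ∈ R3 := memR3_of_supp hD hR (mem_supp_of_memN D hy)
  have hle : ∀ f : Fin 4, (y f).colevel ≤ 3 := fun f => hR y (mem_supp_of_memN D hy) f
  have hnn : ∀ f : Fin 4, 0 ≤ (y f).colevel := fun f => DeepLayerLaws.colevel_nonneg (y f)
  -- kinds on the alphabet: co-level 2 letters are A or B
  have midkind : ∀ f : Fin 4, (y f).colevel = 2 → IsAxFlL (y f) ∨ IsDiagL (y f) := by
    intro f h2
    by_cases hxy : (y f).x * (y f).y = 0
    · exact Or.inl ⟨h2, hxy⟩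
    · exact Or.inr ⟨h2, hxy⟩
  -- STEP 1: no deep letter.  A deep slot d: the other three are charged; by the coarse laws (deep+mid ⇒ hubs; no two deep) they are units.
  have nodeep : ∀ d : Fin 4, (y d).colevel ≠ 3 := by
    intro d hd
    have units : ∀ f : Fin 4, f ≠ d → IsUnitL (y f) := by
      intro f hfd
      have h3 := hle f; have h0 := hch f; have hn := hnn f
      rcases (show (y f).colevel = 1 ∨ (y f).colevel = 2 ∨ (y f).colevel = 3 by omega) with h | h | h
      · exact h
      · -- deep + mid ⇒ the remaining slots are hubs, contradiction with charged
        obtain ⟨s, hs1, hs2, -⟩ := exists_fourth d f f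
        have e := r3N_deep_mid_hub hD hdisj hrule hR hy (Ne.symm hfd) hs1 hs2 hd h
        exact (hch s (colevel_of_eq_hub e)).elim
      · exact (DeepLayerLaws.ring_top_unique_N hD hdisj hrule hR (by norm_num) hy (Ne.symm hfd) hd h).elim
    -- pick the three unit slots u < s < t among the complement of d
    fin_cases d
    · exact noN_deep_unit_charged hD hR hdisj hrule hfine hy (d := 0) (u := 1) (s := 2) (t := 3) (by decide) (by decide) (by decide)
        (by decide) (by decide) (by decide) hd (units 1 (by decide)) (units 2 (by decide)) (units 3 (by decide))
    · exact noN_deep_unit_charged hD hR hdisj hrule hfine hy (d := 1) (u := 0) (s := 2) (t := 3) (by decide) (by decide) (by decide)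
        (by decide) (by decide) (by decide) hd (units 0 (by decide)) (units 2 (by decide)) (units 3 (by decide))
    · exact noN_deep_unit_charged hD hR hdisj hrule hfine hy (d := 2) (u := 0) (s := 1) (t := 3) (by decide) (by decide) (by decide)
        (by decide) (by decide) (by decide) hd (units 0 (by decide)) (units 1 (by decide)) (units 3 (by decide))
    · exact noN_deep_unit_charged hD hR hdisj hrule hfine hy (d := 3) (u := 0) (s := 1) (t := 2) (by decide) (by decide) (by decide)
        (by decide) (by decide) (by decide) hd (units 0 (by decide)) (units 1 (by decide)) (units 2 (by decide))
  refine ⟨nodeep, ?_⟩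
  -- STEP 2: no two mid letters.
  intro f g hfg hf hg
  -- every slot is a unit or a mid letter now
  have um : ∀ s : Fin 4, (y s).colevel = 1 ∨ (y s).colevel = 2 := by
    intro s; have := hle s; have := hch s; have := hnn s; have := nodeep s; omega
  -- case split on the kinds of f and g
  rcases midkind f hf with hAf | hBf <;> rcases midkind g hg with hAg | hBg
  · -- A, A: the other two slots are units or A (a `B` there contradicts the two-mid law), then `noN_AA_charged`
    obtain ⟨s, hsf, hsg, -⟩ := exists_fourth f g g
    obtain ⟨t, htf, htg, hts⟩ := exists_fourth f g s
    have kind : ∀ r : Fin 4, r ≠ f → r ≠ g → IsUnitL (y r) ∨ IsAxFlL (y r) := by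
      intro r hrf hrg
      rcases um r with h1 | h2
      · exact Or.inl h1
      · rcases midkind r h2 with hA | hB
        · exact Or.inr hA
        · exact (hB.2 (r3N_two_mid_axis hD hdisj hrule hR hy hfg hrf hrg hf hg)).elim
    rcases lt_or_gt_of_ne hts with hlt | hlt
    · exact noN_AA_charged hD hR hdisj hrule hfine hy hfg htf.symm hsf.symm htg.symm hsg.symm hlt hAf hAg (kind t htf htg) (kind s hsf hsg)
    · exact noN_AA_charged hD hR hdisj hrule hfine hy hfg hsf.symm htf.symm hsg.symm htg.symm hlt hAf hAg (kind s hsf hsg) (kind t htf htg)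
  · -- A at f, B at g: others units (two mids ⇒ others axis ⇒ not B; and not A? (A,B,A,u): two mids f and the A ⇒ g must be axis ✗)
    obtain ⟨s, hsf, hsg, -⟩ := exists_fourth f g g
    obtain ⟨t, htf, htg, hts⟩ := exists_fourth f g s
    have unit_of : ∀ r : Fin 4, r ≠ f → r ≠ g → IsUnitL (y r) := by
      intro r hrf hrg
      rcases um r with h1 | h2
      · exact h1
      · exact (hBg.2 (r3N_two_mid_axis hD hdisj hrule hR hy (Ne.symm hrf) (Ne.symm hfg) (Ne.symm hrg) hf h2 )).elim
    rcases lt_or_gt_of_ne hts with hlt | hlt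
    · exact noN_mid_B_unit_unit hD hR hdisj hrule hfine hy hfg htf.symm hsf.symm htg.symm hsg.symm hlt hf hBg (unit_of t htf htg) (unit_of s hsf hsg)
    · exact noN_mid_B_unit_unit hD hR hdisj hrule hfine hy hfg hsf.symm htf.symm hsg.symm htg.symm hlt hf hBg (unit_of s hsf hsg) (unit_of t htf htg)
  · -- B at f, A at g: symmetric
    obtain ⟨s, hsf, hsg, -⟩ := exists_fourth f g g
    obtain ⟨t, htf, htg, hts⟩ := exists_fourth f g s
    have unit_of : ∀ r : Fin 4, r ≠ f → r ≠ g → IsUnitL (y r) := by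
      intro r hrf hrg
      rcases um r with h1 | h2
      · exact h1
      · exact (hBf.2 (r3N_two_mid_axis hD hdisj hrule hR hy (Ne.symm hrg) (Ne.symm hfg).symm (Ne.symm hrf) hg h2)).elim
    rcases lt_or_gt_of_ne hts with hlt | hlt
    · exact noN_mid_B_unit_unit hD hR hdisj hrule hfine hy hfg.symm htg.symm hsg.symm htf.symm hsf.symm hlt hg hBf (unit_of t htf htg) (unit_of s hsf hsg)
    · exact noN_mid_B_unit_unit hD hR hdisj hrule hfine hy hfg.symm hsg.symm htg.symm hsf.symm htf.symm hlt hg hBf (unit_of s hsf hsg) (unit_of t htf htg)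
  · -- B, B: others units by the B-law (two mids ⇒ axis; B not axis) — then BBuu
    obtain ⟨s, hsf, hsg, -⟩ := exists_fourth f g g
    obtain ⟨t, htf, htg, hts⟩ := exists_fourth f g s
    have unit_of : ∀ r : Fin 4, r ≠ f → r ≠ g → IsUnitL (y r) := by
      intro r hrf hrg
      rcases um r with h1 | h2
      · exact h1
      · exact (hBg.2 (r3N_two_mid_axis hD hdisj hrule hR hy (Ne.symm hrf) (Ne.symm hfg) (Ne.symm hrg) hf h2)).elim
    rcases lt_or_gt_of_ne hts with hlt | hlt
    · exact noN_mid_B_unit_unit hD hR hdisj hrule hfine hy hfg htf.symm hsf.symm htg.symm hsg.symm hlt hf hBg (unit_of t htf htg) (unit_of s hsf hsg)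
    · exact noN_mid_B_unit_unit hD hR hdisj hrule hfine hy hfg hsf.symm htf.symm hsg.symm htg.symm hlt hf hBg (unit_of s hsf hsg) (unit_of t htf htg)


/-! ### §6b (v1.6) general single-line lifts and the OFF-AXIS COUNTS of `CoverCount` (anomaly g16) discharged behind the fine door

`CoverCount.classA_ten_cells ∕ classB_seven_cells` display the room hypotheses «every hub-free N-cell has ≤ 1 off-axis letter» ∕ «every hub-free
P-cell has ≤ 2 off-axis letters» (off-axis = `x ≠ 0 ∧ y ≠ 0`: the letters `B` and `D`).  Both hold on shell 3 behind the fine door (`OnAlphabet 14 ∧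
RingLe 3 ∧ Disj ∧ RuleD ∧ RuleDPFine`, no (A1)): `offaxisN_le_one_fine_ring3`, `offaxisP_le_two_fine_ring3`, with `offCount` restated definitionally
(`CoverCount` imports the unbuilt `BoxIdentity`). -/

/-- validity of (`annU` on a unit slot, `e_A*` on any non-hub slot of shell 3) and the swapped orientation. -/
theorem detects_unit_any : ∀ u ∈ R2, ∀ ℓ ∈ R3, IsUnitL u → ℓ.colevel ≠ 0 →
    FDetects (annU u) eA !![star ℓ.beta, intG (ℓ.a - u.a); 0, -u.beta] := by decide
theorem detects_unit_any_swap : ∀ ℓ ∈ R3, ∀ u ∈ R2, IsUnitL u → ℓ.colevel ≠ 0 →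
    FDetects eA (annU u) !![star u.beta, intG (u.a - ℓ.a); 0, -ℓ.beta] := by decide
/-- validity of (`annA` on a mid axis slot, `e_A*` on any non-hub slot of shell 3) and the swapped orientation. -/
theorem detects_floor_any : ∀ A ∈ R2, ∀ ℓ ∈ R3, IsAxFlL A → ℓ.colevel ≠ 0 →
    FDetects (annA A) eA !![star ℓ.beta, intG (ℓ.a - A.a); 0, -A.beta] := by decide
theorem detects_floor_any_swap : ∀ ℓ ∈ R3, ∀ A ∈ R2, IsAxFlL A → ℓ.colevel ≠ 0 →
    FDetects eA (annA A) !![star A.beta, intG (A.a - ℓ.a); 0, -ℓ.beta] := by decide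
/-- above a mid diagonal `B`: a unit. -/
theorem above_B3 : ∀ B ∈ R3, ∀ ℓ ∈ R3, IsDiagL B → NullStep B ℓ → ℓ.colevel = 1 := by decide

/-- **U-LIFT (general, shell 3):** `x ∈ suppP` with a unit on `g` and a non-hub letter on `j ≠ g` ⇒ some `x[j ↦ ℓ′] ∈ suppN`, `ℓ′` a null step above `x j`. -/
theorem liftU (hD : D.OnAlphabet 14) (hR : RingLe 3 D) (hdisj : Disj D) (hfine : RuleDPFine D) {x : Cell} (hx : x ∈ D.suppP)
    {g j : Fin 4} (hgj : g ≠ j) (hug : IsUnitL (x g)) (hj : (x j).colevel ≠ 0) :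
    ∃ y ∈ D.suppN, (∀ t : Fin 4, t ≠ j → x t = y t) ∧ NullStep (x j) (y j) := by
  have hxA : ∀ s : Fin 4, (x s).OnAlphabet 14 := fun s => hD x (mem_supp_of_memP D hx) s
  have hxR : ∀ s : Fin 4, x s ∈ R3 := memR3_of_supp hD hR (mem_supp_of_memP D hx)
  have hgR : x g ∈ R2 := unit_mem_R2 (hxA g) hug
  have hg13 : (x g).a = 13 := (R2_shape_levels _ hgR).1 hug
  rcases lt_or_gt_of_ne hgj with hlt | hlt
  · have hval : DMassValid x g j (annU (x g)) eA := ⟨hlt, Or.inl (detects_unit_any _ hgR _ (hxR j) hug hj)⟩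
    obtain ⟨y, hy, hc⟩ := hfine x hx g j _ _ hval
    have hyA : ∀ s : Fin 4, (y s).OnAlphabet 14 := fun s => hD y (mem_supp_of_memN D hy) s
    rcases hc with heq | ⟨hleg, hna⟩ | ⟨hleg, -⟩ | ⟨hr, hna, -⟩
    · exact (hdisj y hy (heq ▸ hx)).elim
    · exact (hna (annU_annihilates _ hgR _ (above_unit_mem_R2 (hyA g) hleg.1 hg13).1 hug hleg.1)).elim
    · exact ⟨y, hy, hleg.2, hleg.1⟩
    · exact (hna (annU_annihilates _ hgR _ (above_unit_mem_R2 (hyA g) hr.2.1 hg13).1 hug hr.2.1)).elim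
  · have hval : DMassValid x j g eA (annU (x g)) := ⟨hlt, Or.inl (detects_unit_any_swap _ (hxR j) _ hgR hug hj)⟩
    obtain ⟨y, hy, hc⟩ := hfine x hx j g _ _ hval
    have hyA : ∀ s : Fin 4, (y s).OnAlphabet 14 := fun s => hD y (mem_supp_of_memN D hy) s
    rcases hc with heq | ⟨hleg, -⟩ | ⟨hleg, hna⟩ | ⟨hr, -, hnb⟩
    · exact (hdisj y hy (heq ▸ hx)).elim
    · exact ⟨y, hy, hleg.2, hleg.1⟩
    · exact (hna (annU_annihilates _ hgR _ (above_unit_mem_R2 (hyA g) hleg.1 hg13).1 hug hleg.1)).elim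
    · exact (hnb (annU_annihilates _ hgR _ (above_unit_mem_R2 (hyA g) hr.2.2.1 hg13).1 hug hr.2.2.1)).elim

/-- **A-LIFT (general, shell 3):** `x ∈ suppP` with a mid axis letter on `g` and a non-hub letter on `j ≠ g` ⇒ some `x[j ↦ ℓ′] ∈ suppN`. -/
theorem liftA (hD : D.OnAlphabet 14) (hR : RingLe 3 D) (hdisj : Disj D) (hfine : RuleDPFine D) {x : Cell} (hx : x ∈ D.suppP)
    {g j : Fin 4} (hgj : g ≠ j) (hA : IsAxFlL (x g)) (hj : (x j).colevel ≠ 0) :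
    ∃ y ∈ D.suppN, (∀ t : Fin 4, t ≠ j → x t = y t) ∧ NullStep (x j) (y j) := by
  have hxA : ∀ s : Fin 4, (x s).OnAlphabet 14 := fun s => hD x (mem_supp_of_memP D hx) s
  have hxR : ∀ s : Fin 4, x s ∈ R3 := memR3_of_supp hD hR (mem_supp_of_memP D hx)
  have hgR : x g ∈ R2 := axfl_mem_R2 (hxA g) hA
  have hg12 : (x g).a = 12 := (R2_shape_levels _ hgR).2.1 hA
  rcases lt_or_gt_of_ne hgj with hlt | hlt
  · have hval : DMassValid x g j (annA (x g)) eA := ⟨hlt, Or.inl (detects_floor_any _ hgR _ (hxR j) hA hj)⟩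
    obtain ⟨y, hy, hc⟩ := hfine x hx g j _ _ hval
    have hyA : ∀ s : Fin 4, (y s).OnAlphabet 14 := fun s => hD y (mem_supp_of_memN D hy) s
    rcases hc with heq | ⟨hleg, hna⟩ | ⟨hleg, -⟩ | ⟨hr, hna, -⟩
    · exact (hdisj y hy (heq ▸ hx)).elim
    · exact (hna (annA_annihilates _ hgR _ (above_floor_mem_R2 (hyA g) hleg.1 hg12).1 hA hleg.1)).elim
    · exact ⟨y, hy, hleg.2, hleg.1⟩
    · exact (hna (annA_annihilates _ hgR _ (above_floor_mem_R2 (hyA g) hr.2.1 hg12).1 hA hr.2.1)).elim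
  · have hval : DMassValid x j g eA (annA (x g)) := ⟨hlt, Or.inl (detects_floor_any_swap _ (hxR j) _ hgR hA hj)⟩
    obtain ⟨y, hy, hc⟩ := hfine x hx j g _ _ hval
    have hyA : ∀ s : Fin 4, (y s).OnAlphabet 14 := fun s => hD y (mem_supp_of_memN D hy) s
    rcases hc with heq | ⟨hleg, -⟩ | ⟨hleg, hna⟩ | ⟨hr, -, hnb⟩
    · exact (hdisj y hy (heq ▸ hx)).elim
    · exact ⟨y, hy, hleg.2, hleg.1⟩
    · exact (hna (annA_annihilates _ hgR _ (above_floor_mem_R2 (hyA g) hleg.1 hg12).1 hA hleg.1)).elim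
    · exact (hnb (annA_annihilates _ hgR _ (above_floor_mem_R2 (hyA g) hr.2.2.1 hg12).1 hA hr.2.2.1)).elim

/-- P: deep + mid ⇒ the other two slots axis (`RingThreeAnatomy.r3P_deep_mid_axis`, first half; one-liner from `DeepLayerLaws.sum_rule_P_axis`). -/
theorem r3P_deep_mid_axis (hA : D.OnAlphabet 14) (hdis : Disj D) (hr : RuleD D) (hR : RingLe 3 D) {x : Cell} (hx : x ∈ D.suppP)
    {g j s : Fin 4} (hgj : g ≠ j) (hsg : s ≠ g) (hsj : s ≠ j) (hg : (x g).colevel = 3) (hj : (x j).colevel = 2) :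
    (x s).x * (x s).y = 0 :=
  DeepLayerLaws.sum_rule_P_axis hA hdis hr hR (by norm_num) hx hgj hsg hsj (by rw [hg, hj]; norm_num)

/-- the number of OFF-AXIS letters (`x ≠ 0 ∧ y ≠ 0`) of a cell — definitionally `CoverCount.offCount` (`nOff ∘ offB`). -/
def offCount (c : Cell) : ℕ := (Finset.univ.filter fun f : Fin 4 => decide ((c f).x ≠ 0 ∧ (c f).y ≠ 0) = true).card

theorem offCount_le_one_of {c : Cell} (h : ∀ f g : Fin 4, f ≠ g → (c f).x * (c f).y ≠ 0 → (c g).x * (c g).y ≠ 0 → False) :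
    offCount c ≤ 1 := by
  unfold offCount
  refine Finset.card_le_one.mpr fun a ha b hb => ?_
  by_contra hab
  have ha' := of_decide_eq_true (Finset.mem_filter.mp ha).2
  have hb' := of_decide_eq_true (Finset.mem_filter.mp hb).2
  exact h a b hab (mul_ne_zero ha'.1 ha'.2) (mul_ne_zero hb'.1 hb'.2)

theorem offCount_le_two_of {c : Cell}
    (h : ∀ f g k : Fin 4, f ≠ g → f ≠ k → g ≠ k → (c f).x * (c f).y ≠ 0 → (c g).x * (c g).y ≠ 0 → (c k).x * (c k).y ≠ 0 → False) :
    offCount c ≤ 2 := by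
  unfold offCount
  by_contra hlt
  obtain ⟨a, ha, b, hb, d, hd, hab, had, hbd⟩ := Finset.two_lt_card.mp (not_le.mp hlt)
  have ha' := of_decide_eq_true (Finset.mem_filter.mp ha).2
  have hb' := of_decide_eq_true (Finset.mem_filter.mp hb).2
  have hd' := of_decide_eq_true (Finset.mem_filter.mp hd).2
  exact h a b d hab had hbd (mul_ne_zero ha'.1 ha'.2) (mul_ne_zero hb'.1 hb'.2) (mul_ne_zero hd'.1 hd'.2)

/-- **N side of `CoverCount` discharged:** behind the fine door on shell 3 every hub-free supported N-cell has at most ONE off-axis letter. -/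
theorem offaxisN_le_one_fine_ring3 (hD : D.OnAlphabet 14) (hR : RingLe 3 D) (hdisj : Disj D) (hrule : RuleD D) (hfine : RuleDPFine D)
    {y : Cell} (hy : y ∈ D.suppN) (hch : ∀ f : Fin 4, ¬((y f).x = 0 ∧ (y f).y = 0)) : offCount y ≤ 1 := by
  have hch' : ∀ f : Fin 4, (y f).colevel ≠ 0 := by
    intro f h0
    have hx := abs_nonneg (y f).x; have hy' := abs_nonneg (y f).y
    unfold Letter.colevel at h0
    exact hch f ⟨abs_eq_zero.mp (by omega), abs_eq_zero.mp (by omega)⟩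
  obtain ⟨nodeep, onemid⟩ := charged_N_fine_ring3 hD hR hdisj hrule hfine hy hch'
  have hle : ∀ f : Fin 4, (y f).colevel ≤ 3 := fun f => hR y (mem_supp_of_memN D hy) f
  -- an off-axis letter of co-level ≤ 3 that is not deep has co-level 2 (units are axis)
  have offmid : ∀ f : Fin 4, (y f).x * (y f).y ≠ 0 → (y f).colevel = 2 := by
    intro f hf
    have hx0 : (y f).x ≠ 0 := fun h => hf (by rw [h, zero_mul])
    have hy0 : (y f).y ≠ 0 := fun h => hf (by rw [h, mul_zero])
    have hxa : 1 ≤ |(y f).x| := Int.one_le_abs hx0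
    have hya : 1 ≤ |(y f).y| := Int.one_le_abs hy0
    have := hle f; have := nodeep f
    unfold Letter.colevel at *
    omega
  exact offCount_le_one_of fun f g hfg hf hg => onemid f g hfg (offmid f hf) (offmid g hg)

/-- **(N, fine∕coarse) no supported N-cell has two mid DIAGONAL slots, a third mid slot and a charged fourth slot** (`BBB·`, `ABB·`): two mids force the
other slots to be axis. -/
theorem noN_BB_mid (hD : D.OnAlphabet 14) (hR : RingLe 3 D) (hdisj : Disj D) (hrule : RuleD D) {y : Cell} (hy : y ∈ D.suppN)
    {b₁ b₂ m : Fin 4} (h12 : b₁ ≠ b₂) (h1m : b₁ ≠ m) (h2m : b₂ ≠ m) (hB1 : IsDiagL (y b₁)) (hB2 : IsDiagL (y b₂))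
    (hm : (y m).colevel = 2) : False :=
  hB2.2 (r3N_two_mid_axis hD hdisj hrule hR hy h1m h12.symm h2m hB1.1 hm)

/-- **P side of `CoverCount` discharged:** behind the fine door on shell 3 every hub-free supported P-cell has at most TWO off-axis letters
(the P-cells `BBBB ∕ BBBu ∕ BBBA` are fine-dead: their unit-∕A-slot lifts or coarse witnesses are N-cells with two `B` and a third mid, or the
kernel-dead N `BBuu`; any deep letter next to a `B` forces the rest to co-level ≤ 1). -/
theorem offaxisP_le_two_fine_ring3 (hD : D.OnAlphabet 14) (hR : RingLe 3 D) (hdisj : Disj D) (hrule : RuleD D) (hfine : RuleDPFine D)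
    {x : Cell} (hx : x ∈ D.suppP) (hch : ∀ f : Fin 4, ¬((x f).x = 0 ∧ (x f).y = 0)) : offCount x ≤ 2 := by
  have hxR : ∀ f : Fin 4, x f ∈ R3 := memR3_of_supp hD hR (mem_supp_of_memP D hx)
  have hle : ∀ f : Fin 4, (x f).colevel ≤ 3 := fun f => hR x (mem_supp_of_memP D hx) f
  have hnn : ∀ f : Fin 4, 0 ≤ (x f).colevel := fun f => DeepLayerLaws.colevel_nonneg (x f)
  have hch' : ∀ f : Fin 4, (x f).colevel ≠ 0 := by
    intro f h0
    have hx' := abs_nonneg (x f).x; have hy' := abs_nonneg (x f).y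
    unfold Letter.colevel at h0
    exact hch f ⟨abs_eq_zero.mp (by omega), abs_eq_zero.mp (by omega)⟩
  -- an off-axis letter is `B` (co-level 2) or `D` (co-level 3)
  have offkind : ∀ f : Fin 4, (x f).x * (x f).y ≠ 0 → IsDiagL (x f) ∨ (x f).colevel = 3 := by
    intro f hf
    have hx0 : (x f).x ≠ 0 := fun h => hf (by rw [h, zero_mul])
    have hy0 : (x f).y ≠ 0 := fun h => hf (by rw [h, mul_zero])
    have hxa : 1 ≤ |(x f).x| := Int.one_le_abs hx0
    have hya : 1 ≤ |(x f).y| := Int.one_le_abs hy0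
    have h3 := hle f
    have : (x f).colevel = 2 ∨ (x f).colevel = 3 := by unfold Letter.colevel at *; omega
    rcases this with h2 | h3'
    · exact Or.inl ⟨h2, hf⟩
    · exact Or.inr h3'
  refine offCount_le_two_of fun f g k hfg hfk hgk hf hg hk => ?_
  obtain ⟨t, htf, htg, htk⟩ := exists_fourth f g k
  -- (a) a deep off-axis letter among f g k: deep + B ⇒ the others have co-level ≤ 1 (contradiction with a third off-axis letter), or two deep ⇒ hubs
  have deepB : ∀ {p q r : Fin 4}, p ≠ q → p ≠ r → q ≠ r → (x p).colevel = 3 → IsDiagL (x q) → (x r).x * (x r).y ≠ 0 → False := by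
    intro p q r hpq hpr hqr hp hq hr
    have hax := r3P_deep_mid_axis hD hdisj hrule hR hx hpq hpr.symm hqr.symm hp hq.1
    exact hr hax
  have twodeep : ∀ {p q r : Fin 4}, p ≠ q → p ≠ r → q ≠ r → (x p).colevel = 3 → (x q).colevel = 3 → False := by
    intro p q r hpq hpr hqr hp hq
    have e := r3P_two_deep_hub hD hdisj hrule hR hx hpq hpr.symm hqr.symm hp hq
    exact hch' r (colevel_of_eq_hub e)
  rcases offkind f hf with hBf | hDf <;> rcases offkind g hg with hBg | hDg <;> rcases offkind k hk with hBk | hDk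
  · -- B B B: the fourth slot t is charged; lift or coarse witness
    rcases (show (x t).colevel = 1 ∨ (x t).colevel = 2 ∨ (x t).colevel = 3 by
        have := hle t; have := hch' t; have := hnn t; omega) with ht1 | ht2 | ht3
    · -- BBBu: U-lift at (t, f): y = x[f ↦ unit] is a hub-free N-cell (u, B, B, u) = BBuu ✗ (kernel) — via noN_mid_B_unit_unit
      obtain ⟨y, hy, heq, hn⟩ := liftU hD hR hdisj hfine hx htf ht1 (hch' f)
      have hyR : ∀ s : Fin 4, y s ∈ R3 := memR3_of_supp hD hR (mem_supp_of_memN D hy)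
      have hyf : (y f).colevel = 1 := above_B3 _ (hxR f) _ (hyR f) hBf hn
      have hyg : IsDiagL (y g) := by rw [← heq g hfg.symm]; exact hBg
      have hyk : IsDiagL (y k) := by rw [← heq k hfk.symm]; exact hBk
      have hyt : IsUnitL (y t) := by rw [← heq t htf]; exact ht1
      -- two B (g, k) and two units (f, t): order the unit slots
      rcases lt_or_gt_of_ne htf with hlt | hlt
      · exact noN_mid_B_unit_unit hD hR hdisj hrule hfine hy hgk.symm.symm (htg).symm hfg.symm htk.symm hfk.symm hlt hyg.1 hyk hyt hyf
      · exact noN_mid_B_unit_unit hD hR hdisj hrule hfine hy hgk hfg.symm htg.symm hfk.symm htk.symm hlt hyg.1 hyk hyf hyt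
    · -- BBB + mid at t: if t is A, A-lift at (t, f) gives N (A,u,B,B): two mids t,g ⇒ k axis ✗; if t is B: coarse witness at block (f, g)
      by_cases hAt : (x t).x * (x t).y = 0
      · obtain ⟨y, hy, heq, hn⟩ := liftA hD hR hdisj hfine hx htf ⟨ht2, hAt⟩ (hch' f)
        have hyg : IsDiagL (y g) := by rw [← heq g hfg.symm]; exact hBg
        have hyk : IsDiagL (y k) := by rw [← heq k hfk.symm]; exact hBk
        have hyt : (y t).colevel = 2 := by rw [← heq t htf]; exact ht2
        exact noN_BB_mid hD hR hdisj hrule hy hgk htg.symm htk.symm hyg hyk hyt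
      · -- BBBB: coarse witness at (f, g): y agrees off {f,g}; y f, y g ∈ {B, unit above}; not both equal
        have hdet : Detects x f g := by
          intro h; exact hch f ⟨h.1, h.2.1⟩
        obtain ⟨y, hy, hsup⟩ := witness_of_P hrule hx hfg hdet
        have hyR : ∀ s : Fin 4, y s ∈ R3 := memR3_of_supp hD hR (mem_supp_of_memN D hy)
        have hyk : IsDiagL (y k) := by rw [← hsup.1 k hfk.symm hgk.symm]; exact hBk
        have hyt : IsDiagL (y t) := by rw [← hsup.1 t htf htg]; exact ⟨ht2, hAt⟩
        rcases hsup.2.1 with ef | nf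
        · rcases hsup.2.2 with eg | ng
          · exact hdisj y hy ((cell_eq_of_supplies hsup ef eg) ▸ hx)
          · -- y = (B at f, unit at g, B at k, B at t): two B (k, t) + mid f ✗
            have hyf : (y f).colevel = 2 := by rw [← ef]; exact hBf.1
            exact noN_BB_mid hD hR hdisj hrule hy htk.symm (Ne.symm hfk) htf hyk hyt hyf
        · have hyf : (y f).colevel = 1 := above_B3 _ (hxR f) _ (hyR f) hBf nf
          rcases hsup.2.2 with eg | ng
          · have hyg : (y g).colevel = 2 := by rw [← eg]; exact hBg.1
            exact noN_BB_mid hD hR hdisj hrule hy htk.symm (Ne.symm hgk) htg hyk hyt hyg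
          · -- both raised to units: y = (u, u, B, B) = BBuu ✗ kernel
            have hyg : (y g).colevel = 1 := above_B3 _ (hxR g) _ (hyR g) hBg ng
            rcases lt_or_gt_of_ne hfg with hlt | hlt
            · exact noN_mid_B_unit_unit hD hR hdisj hrule hfine hy htk.symm hfk.symm hgk.symm htf htg hlt hyk.1 hyt hyf hyg
            · exact noN_mid_B_unit_unit hD hR hdisj hrule hfine hy htk.symm hgk.symm hfk.symm htg htf hlt hyk.1 hyt hyg hyf
    · -- t deep and f is B: deep + B ⇒ g axis, contradiction
      exact deepB htf htg hfg ht3 hBf hg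
  · exact deepB hfk.symm hgk.symm hfg hDk hBf hg
  · exact deepB hfg.symm hgk hfk hDg hBf hk
  · exact twodeep hgk hfg.symm hfk.symm hDg hDk
  · exact deepB hfg hfk hgk hDf hBg hk
  · exact twodeep hfk hfg hgk.symm hDf hDk
  · exact twodeep hfg hfk hgk hDf hDg
  · exact twodeep hfg hfk hgk hDf hDg

end

end Summit.HodgeConjecture.HodgeConjecture.Cruxes.BlochSeedDiscOne.FineDoorRing2
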